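import Literature.MathematicalPhysics.QuantumFieldTheory.Balaban1983to89.B12Form13Step268
import Literature.MathematicalPhysics.QuantumFieldTheory.Balaban1983to89.B12Eq21Body265
import Literature.MathematicalPhysics.QuantumFieldTheory.Balaban1983to89.B16EflSup
import Literature.MathematicalPhysics.QuantumFieldTheory.Balaban1983to89.B2Eq228Conditioning
import Literature.MathematicalPhysics.QuantumFieldTheory.Balaban1983to89.B12Eq216MeasureCovariance
import Literature.MathematicalPhysics.QuantumFieldTheory.Balaban1983to89.Beta.ConstraintElimination
import Literature.MathematicalPhysics.QuantumFieldTheory.Balaban1983to89.B12ChiInvariance269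
import Literature.MathematicalPhysics.QuantumFieldTheory.Balaban1983to89.B10Eq26MeasureInv

/-!
# `Balaban1983to89.B12Eq213Body268` — T. Bałaban, *Renormalization group approach to lattice gauge field theories. I*,
Commun. Math. Phys. **109** (1987) 249–301 [Balaban1987RG1], (2.12)/(2.13)/(2.14) p. 268: **the new term
`𝐄^{(k+1)}(g_k, U_{k+1}) = log ∫dμ_{C^{(k)}}(B) χ_k exp[𝐏^{(k)}(g_k, U_{k+1}, B) + {…}]` WITH BODY**, the normalization constant
`𝐍″_k` (*«equal to the integral above at U_{k+1} = 1»*), (2.14) `log 𝐍″_k = 𝐄^{(k+1)}(g_k, 1)` as a theorem of the body, and the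
right side of (2.12) WITH BODY — whose substituted form is EXACTLY the hypothesis `h212` of `B12Form13Step268.form13_succ_of_eq212`
(unit `lit-balaban-r09` gen 40), thereby discharged.

HONEST FRAMING (cell `lit-balaban`, verbatim): statement-level skeleton of published theorems with citation tags; proofs where landed; nothing here is a claim about the Yang–Mills mass gap.

CITATION HEADER (lean-in-tree rule 2026-08-18).  PDF page = journal page − 248 (PDF held: `paper:balaban1987-cmp109-rg-i-small-field`);
render `1987-cmp109-rg-I-small-field-p020-x2.png` (p. 268) read first-hand by the writing seat (unit `lit-balaban-r20` gen 45, fold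
owner of block B12; display rows B12.Eq2.12 / B12.Eq2.13 / B12.Eq2.14 of `HOME/lit-balaban-r09/ROWS-B12.md`, coarse row B12.Eq2.13
«§2 (2.12)–(2.15)» of `HOME/lit-balaban-r20/ROWS-B12.md`).

THE PRINT (p. 268 [PDF 20], verbatim; linear transcription of the display).  *«After these transformations we obtain the following
expression for the new action:»*
`A_{k+1}(U_{k+1}) = −(1/g_k²)A(U_{k+1}) + 𝐄_k(U_{k+1}) + [log Z^{(k)}(U_{k+1}) − log Z^{(k)}(1)]`
`  + log 𝐍″_k⁻¹ ∫dμ_{C^{(k)}}(B) χ_k exp[ Tr log(I − h((δ/δB)D̃)(g_kCB)) + log σ(g_kCB − hD̃(g_kCB)) + (1/g_k²)⟨H₁hD̃₃(g_kCB), J⟩`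
`  − (1/g_k²)G₃(g_kB) + (1/g_k²)⟨H₁g_kCB, Δ₁H₁hD̃(g_kCB)⟩ − (1/g_k²)⟨H₁hD̃(g_kCB), Δ₁H₁hD̃(g_kCB)⟩ − (1/g_k²)V(H₁(g_kCB − hD̃(g_kCB)))`
`  + {𝐄_k(U_k(exp i[g_kCB − hD̃(g_kCB)]V^{(k)})) − 𝐄_k(U_k(V^{(k)}))} ]   (2.12)`
*«Let us notice that the normalization constant 𝐍″_k is equal to the integral above at U_{k+1} = 1. The expression under the
exponential is clearly a sum of two terms, one is connected with the expansion of the action −(1/g_k²)A(U_k(V)) and the measure in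
(2.1), and we denote it by 𝐏^{(k)}(g_k, U_{k+1}, B), another is the expression in the curly bracket {…}. The integral in (2.12)
defines the new term 𝐄^{(k+1)} in the inductive definition of the action A_{k+1} by the formula*
`𝐄^{(k+1)}(g_k, U_{k+1}) = log ∫dμ_{C^{(k)}}(B) χ_k exp[𝐏^{(k)}(g_k, U_{k+1}, B) + {…}] .   (2.13)`
*Let us remark that the expression under the exponential above vanishes at g_k = 0, and*
`log 𝐍″_k = 𝐄^{(k+1)}(g_k, 1) .   (2.14)`*»*
(Earlier on p. 268: *«the measure becomes a Gaussian measure in variables B, with the covariance C^{(k)} = C^{(k)}(U_{k+1}) =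
(C*Δ^{(k)}C)⁻¹»*; p. 265 (2.1): *«The meaning of the function 𝐄_k is obvious, it is equal to (1/g_k²)A + A_k»*.)

THE TYPING (the cell's reading; ours, not print's words).
* The data print feeds into (2.13) at step `k` is a PARAMETER record `FluctData X` over a configuration type `X` (the background
  fields `U_{k+1}`; for (2.12) `X = GaugeField P 0 G`, as in the tree's form (1.3) `Step.SFTower.action13`): the fluctuation
  variables `B` (*«Denoting the remaining variables by B»*) as a measurable space `𝓑`, the Gaussian measures `dμ_{C^{(k)}(U_{k+1})}(B)`
  as a `U_{k+1}`-indexed family of PROBABILITY measures (read as normalised — the Gaussian normalization `Z^{(k)}` is the separate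
  bracket of (2.12), as in `B16EflSup.FluctuationIntegral`), the small-field characteristic function `χ_k` with values in `[0, 1]`
  ((2.9) p. 266: a product of characteristic functions; it depends on `U_{k+1}` through `V^{(k)}`), and the two named parts of the
  exponent, `𝐏^{(k)}(g_k, U_{k+1}, B)` and the curly bracket `{…}(g_k, U_{k+1}, B)`, as real functions of the coupling, the
  configuration and `B`.  NOTHING of the §2 computation (2.2)–(2.11) that produces these objects from (2.1) is reproduced: which
  `𝓑, μ, χ, 𝐏, {…}` realise print's is not decided here (their typed pieces live in `B12Lineariz267`, `B12SecondOrder267`,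
  `B12JacobianTrLog268`, `B12ZeroCoupling268`, `B13HaarSigmaJacobian`, …, rows B12.Eq2.2–2.12 of the r09 file).
* (2.13) is then a DEFINITION WITH BODY: `FluctData.newTerm D g U := log (FluctData.integral D g U)`,
  `FluctData.integral D g U := ∫ χ_U(B)·exp[𝐏(g, U, B) + {…}(g, U, B)] dμ_U(B)` (*«the integral above»*); `𝐍″_k` is
  `FluctData.normConst D g := FluctData.integral D g 1`, and **(2.14) holds by `rfl`** (`FluctData.log_normConst`).
* (2.12) WITH BODY: `action212 T k D U` := print's right side, its first two terms `−(1/g_k²)A(U_{k+1}) + 𝐄_k(U_{k+1})` written with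
  the p. 265 sentence *«𝐄_k … is equal to (1/g_k²)A + A_k»* as `B12Eq21Body265.EkOf g_k A A_k` at `A_k :=` the form (1.3)
  `Step.SFTower.action13 T k` (so that the two terms ARE `A_k`'s own expression read at the new background field, `action212_firstLine`;
  the bookkeeping is that of (1.3), zeroth-order terms separated, as the next bracket `[log Z^{(k)}(U_{k+1}) − log Z^{(k)}(1)]` of
  (2.12) shows), then `+ [log Z^{(k)}(U) − log Z^{(k)}(1)] + log(𝐍″_k⁻¹ · ∫…)`.
* WHAT IS PROVED: `action212_one` (`A_{k+1}(1) = 0` — unconditional, Lean's `log 0 = 0` covering the degenerate case — consistent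
  with the normalization of (0.19), `B12Eq019ActionBody.nextAction_one`); **`action212_eq`**: whenever the two integrals (at `U` and
  at `1`) are non-zero, `action212 T k D U = action13 T k U + ([log Z^{(k)}(U) − log Z^{(k)}(1)] + [newTerm(g_k, U) − newTerm(g_k, 1)])`
  — (2.12) with (2.13) and (2.14) substituted, i.e. LITERALLY the hypothesis `h212` of r09's `B12Form13Step268.form13_succ_of_eq212`
  once the tower's `(k+1)`-st total term `Re Σ_X E^{(k+1)}(X, g_k, ·)` is the body `newTerm` (print's sentence *«The integral in (2.12)
  defines the new term 𝐄^{(k+1)} in the inductive definition of the action A_{k+1}»*, hypothesis `hdef`); hence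
  **`form13_succ_of_action212`**: an action given on a domain by the body of (2.12), under (2.15), IS of the form (1.3) at `k+1`
  (`h212` DISCHARGED; the `form13` clause of `Step.GeneratedBySmallFieldRT` at the next index — `form13_succ_of_action212_background`;
  and for the (0.19) body `B12Eq019ActionBody.nextAction`, `form13_succ_of_nextAction_eq_action212`, where the remaining hypothesis
  `nextAction … = action212 … ∘ U_{k+1}` on the small-field domain IS print's equation (2.12), the §2 computation);
  `exp_action212` (the exponentiated step); *«vanishes at g_k = 0»* ⇒ `newTerm_of_exponent_zero` / `newTerm_nonpos_of_exponent_nonpos` /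
  `newTerm_eq_zero_of_exponent_zero_of_chi_one`; `integral_pos_iff` (the integral is positive iff `μ_U(supp χ_U) > 0`, for an
  integrable integrand) and `newTerm_le_of_supBound`.
* STEWARD BRIDGE (no homonym pair is born): the B16 lineage's carrier `B16EflSup.FluctuationIntegral` IS this datum at one
  configuration — `FluctData.toFluct D g U` — and its constant `FluctuationIntegral.E` (*«(2.13) at U_{k+1} = 1 … = log 𝐍″_k»*) is
  `newTerm` by `rfl` (`newTerm_eq_E`, `log_normConst_eq_E`).
No named `Prop` facts; no `sorry`; nothing about convergence, analyticity or the bounds (1.18) of the new term (§§3–5, rows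
B12.Eq3.* ff.).

v1.1 (gen 45, APPEND-ONLY; §§1–2 byte-identical): §3 = p. 269 [PDF 21], the INVARIANCE MECHANISM of (2.16)–(2.18) for the body —
verbatim: *«all the expressions in (2.12), together with the measure, are invariant with respect to the gauge transformations
U_{k+1} → U^u_{k+1}, B′ → R(u)B′, (R(u)B′)(b) = R(u(b₋))B′(b). (2.16) The characteristic function is invariant with respect to the
transformations of the fluctuation field B′, because they are local, orthogonal transformations; therefore the expression (2.13) is
gauge invariant.»* and, for a Euclidean symmetry `r` (2.17)–(2.18), *«The transformation (2.18) generates an orthogonal transformation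
of the fluctuation field B′, hence all the remaining operations preserve the invariance for the same reasons as for the gauge
invariance.»* — as kernel algebra over the datum: for ANY background map `τ : X → X` (`U_{k+1} ↦ U^u_{k+1}`, or `U ↦ rU`) and ANY
measurable equivalence `e` of the B-space (`B′ ↦ R(u)B′`, or the orthogonal map generated by (2.18)) such that the measures are
covariant (`(μ_U).map e = μ_{τU}`), `χ_k` and the two exponent parts are jointly invariant, the integral, the new term (2.13) and —
given the invariance of the first line and of the `Z^{(k)}`-bracket — the whole body of (2.12) are invariant
(`FluctData.integral_eq_of_covariant`, `newTerm_eq_of_covariant`, `normConst` untouched, `action212_eq_of_covariant`); the change of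
variables is Mathlib's `MeasureTheory.integral_map_equiv` (the same mechanism as the B10 twin `B10Eq26MeasureInv.integral_eq_of_cov`
for [Balaban1985UV3] (26)).  Which `τ, e` realise print's `u ↦ (U^u, R(u)B′)` and that THEY satisfy the three covariances is rows
B12.Eq2.16 / B12.Eq2.17-2.18 (`B12ChiInvariance269`, `B12EuclTransf218`, `B12Average012Covariance`), not this file.

v1.2 (gen 45, APPEND-ONLY; §§1–3 byte-identical; one import added, `B2Eq228Conditioning`): §4 = p. 268 [PDF 20], the MEASURE CLAUSE
of (2.11)/(2.12) WITH BODY — verbatim: *«we eliminate the variables B′(b₀(c)), c ∈ T^{(k+1)}. Denoting the remaining variables by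
B we have B′ = CB, C is the operator determined by the configuration V^{(k)}, and the measure becomes a Gaussian measure in
variables B, with the covariance C^{(k)} = C^{(k)}(U_{k+1}) = (C*Δ^{(k)}C)⁻¹.»* — the datum whose measures ARE the tree's
normalised Gaussian `B2Eq228Conditioning.gaussProb` (Lebesgue measure with density `e^{−½⟨B, M B⟩}/∫e^{−½⟨B, M B⟩}`, [Balaban1982Higgs2]
(2.28) lineage, = Mathlib's `multivariateGaussian 0 M⁻¹` in coordinates) at the PRECISION `M = C*Δ^{(k)}(U)C` (`prec212 Cop Δ U :=
Copᵀ * Δ U * Cop`; `⟨B, (CᵀΔC)B⟩ = ⟨CB, Δ(CB)⟩`, `quadForm_prec212` — print's substitution `B′ = CB` in the quadratic form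
`½⟨B′, Δ^{(k)}B′⟩` of (2.11); positive definite when `Δ^{(k)}(U)` is and `C` is injective, `posDef_prec212`): `FluctData.gaussian`;
its integral unfolded to Lebesgue form `(∫e^{−½⟨B,MB⟩})⁻¹ ∫ e^{−½⟨B,MB⟩} χ_k e^{𝐏+{…}} dB` (`integral_gaussian_eq`; so (2.13) =
`log ∫ e^{−½⟨B,MB⟩}χ_k e^{…} − log ∫e^{−½⟨B,MB⟩}`, `newTerm_gaussian_eq` — the separation of the Gaussian normalisation that (2.12)
records as its `Z^{(k)}`-bracket, cf. (1.4)), and print's COVARIANCE SENTENCE as a theorem: the coordinates of `B` under `gaussProb M`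
have covariance matrix `M⁻¹` (`covariance_gaussProb`, from Mathlib's `covariance_eval_multivariateGaussian` through
`gaussProb_eq_map_multivariateGaussian`), hence under the datum at `prec212` the covariance is `(C*Δ^{(k)}(U)C)⁻¹ = C^{(k)}(U)`
(`covariance_gaussian_prec212`).  Which `C`, `Δ^{(k)}` realise print's (the elimination by `δ(Q̃B′)`, [13] (3.156)–(3.158)) is rows
B12.Eq2.11 / B9 (`Beta.ConstraintElimination.elim`, `B9SectECov.eq_3157`), not this file; the identification of (1.4)'s `Z^{(k)}(U)`
with `∫e^{−½⟨B, (C*Δ^{(k)}C)B⟩}` up to the elimination Jacobian is NOT asserted.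

v1.3 (gen 46, APPEND-ONLY; §§1–4 byte-identical; one import added, `B12Eq216MeasureCovariance`): §5 = p. 269 [PDF 21], (2.16)
*«therefore the expression (2.13) is gauge invariant»* FOR THE GAUSSIAN DATUM OF §4, with the measure clause `hμ` of §3 DISCHARGED by
r09's `B12Eq216MeasureCovariance` (unit `lit-balaban-r09` gen 43, p367886) BY NAME: for an orthogonal `R` (`RᵀR = 1`, print's `R(u)` read
on the remaining variables) under which the precision is conjugated, `prec(τU) = R·prec(U)·Rᵀ`, the measures `dμ_{C^{(k)}(U)} =
gaussProb (prec U)` are covariant (`gaussProb_map_covariant` ⇒ `FluctData.gaussian_map_rotEquiv`, `e := rotEquiv R hR`), hence — `χ_k`,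
`𝐏^{(k)}`, `{…}` jointly invariant under `(U, B) ↦ (τU, RB)` — *«the integral above»*, the new term (2.13) and (given `h13`/`hZ` as in §3)
the body of (2.12) are invariant functions of the background (`integral_gaussian_eq_of_covariant`, `newTerm_gaussian_eq_of_covariant`,
`action212_gaussian_eq_of_covariant`).  AT PRINT'S PRECISION `C*Δ^{(k)}(U)C` (`prec212 Cop Δ`): print's transformations (2.16) act on
the field `B′` (*«local, orthogonal transformations»*, matrix `R₁` on `B′`), and on the remaining variables `B` by `R₂` with the
elimination map intertwining, `C R₂ = R₁ C`; then `Δ^{(k)}(τU) = R₁Δ^{(k)}(U)R₁ᵀ` gives `prec(τU) = R₂·prec(U)·R₂ᵀ`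
(r09's `prec_sandwich_covariant`), a function of `B′ = CB` invariant under `R₁` is a function of `B` invariant under `R₂`
(`pullback_invariant_of_intertwine`), and so **`newTerm_gaussian_prec212_eq_of_covariant`**: `𝐄^{(k+1)}(g, τU) = 𝐄^{(k+1)}(g, U)` for
the datum whose `χ_k`, `𝐏^{(k)}`, `{…}` are print's functions of `B′` read at `B′ = CB`, GIVEN their invariance under `B′ ↦ R₁B′`
(the `χ_k` clause is r09's `B12ChiInvariance269.chiFluct_rotFluct` family on its own carrier; the covariance of `Δ^{(k)}` — [13]
(3.156) letters — and the intertwining of `C` are row B12.Eq2.11's; the invariance of `𝐏^{(k)}`/`{…}` is print's *«discussed already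
several times in the previous papers»*): all remain explicit binders, never facts.

v1.4 (gen 46, APPEND-ONLY; §§1–5 byte-identical; one import added, `Beta.ConstraintElimination`): §6 = p. 268 [PDF 20], the
sentence *«Denoting the remaining variables by B we have B′ = CB, C is the operator determined by the configuration V^{(k)}»* READ
IN FULL — `V^{(k)} = V^{(k)}(U_{k+1})` ((2.2)–(2.3)), so the elimination map is BACKGROUND-DEPENDENT, `C = C(U_{k+1})`.  §4's
`prec212 Cop Δ` (v1.2) took `C` constant in the background: a located over-specialisation OF THIS FILE, repaired here without
touching v1.2/v1.3's declarations — `prec212U Cop Δ U := (C(U))ᵀ·Δ^{(k)}(U)·C(U)` for `Cop : X → Matrix ι κ ℝ` (`prec212U_apply`: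
at each `U` it IS `prec212 (Cop U) Δ U`; `prec212U_const`: v1.2's object is the background-constant case, `rfl`), with
`quadForm_prec212U`, `posDef_prec212U`, the background-dependent INTERTWINING `C(τU) R₂ = R₁ C(U)` (the field `B′` transforms by
`R₁`, the remaining variables by `R₂`), `prec212U_covariant` (`Δ^{(k)}(τU) = R₁Δ^{(k)}(U)R₁ᵀ` and the intertwining give
`prec(τU) = R₂·prec(U)·R₂ᵀ`; the constant case is r09's `prec_sandwich_covariant`), `pullback_invariant_of_intertwineU`, and
(2.16) for this datum: `FluctData.gaussian_prec212U_map_rotEquiv`, **`FluctData.newTerm_gaussian_prec212U_eq_of_covariant`**,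
`covariance_gaussian_prec212U` (print's covariance `(C*Δ^{(k)}C)⁻¹` with the `U_{k+1}`-dependence on BOTH factors).  §6b
DISCHARGES THE INTERTWINING for the tree's elimination map `Beta.ConstraintElimination.elim Q_σ Q_κ = [1 ; −Q_κ⁻¹Q_σ]`
([Balaban1985BackgroundPropagators] (3.157), the cell's reading of *«B′ = CB»*): for a bondwise — block-diagonal for the splitting
retained ∕ eliminated — orthogonal `R₁ = diag(Rσ, Rκ)` (*«local, orthogonal transformations»*) and a COVARIANT linear constraint
`Q(τU) R₁ = S(U) Q(U)` (print's `Q̃` of (2.4)/(2.10) transforms by conjugation with `u(Lc₋)` for [I]'s average —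
`B12Average012QtildeCovariance.LQ_gaugeTransformZd`, r09), **`elim_intertwine`**: `C(τU) Rσ = R₁ C(U)` (both sides agree on the
retained coordinates and solve the new constraint; `elim_unique`), whence **`FluctData.newTerm_gaussian_elim_eq_of_covariant`**:
(2.16) for print's Gaussian at the tree's `C(U)` with the binders reduced to the covariance of `Δ^{(k)}` and of `Q̃`, and the
invariance of `χ_k`, `𝐏^{(k)}`, `{…}` as functions of `B′`.  Nothing else asserted; which `Q_σ(U), Q_κ(U), Δ^{(k)}(U)` realise
print's is rows B12.Eq2.4 ∕ Eq2.11 ∕ B9 (3.156)–(3.157).  §7 reads print's invariance sentence LITERALLY for the quadratic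
form `½⟨B′, Δ^{(k)}B′⟩` of (2.11): for symmetric `Δ^{(k)}(·)` and orthogonal `R₁`, invariance of the form under `(U, B′) ↦ (τU, R₁B′)`
IS the conjugation law `Δ^{(k)}(τU) = R₁Δ^{(k)}(U)R₁ᵀ` used as the binder `hΔ` above (`conj_eq_of_quadForm_invariant`, by polarization
`eq_of_isSymm_of_quadForm_eq`; converse `quadForm_invariant_of_conj_eq`; family form `conj_family_of_quadForm_invariant`).

v1.5 (gen 46, APPEND-ONLY; §§1–7 byte-identical; two imports added, `B12ChiInvariance269` and `B10Eq26MeasureInv`): §8 = p. 269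
*«The characteristic function is invariant with respect to the transformations of the fluctuation field B′, because they are local,
orthogonal transformations»* — the `χ_k` BINDER DISCHARGED on print's own carrier.  The datum `FluctData.onBonds μ hμ ε₁ 𝐏 {…}`
(resp. `onBondsPrinted`) has fluctuation variables `B′ ∈ VecField P k 𝔤` (a `𝔤`-valued function on the bonds of `T^{(k)}`), an
arbitrary covariant family of probability measures, and `χ_k :=` r09's `B12SmallFieldDomain259.chiFluct ε₁` (resp. the printed
product (2.9) over `b ∉ {b₀(c)}`, `chiFluctPrinted ε₁`); the transformation `B′ ↦ R(u)B′`, `(R(u)B′)(b) = R(u(b₋))B′(b)`, is a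
bondwise family of linear isometries `f b : 𝔤 ≃ₗᵢ 𝔤` packaged as r07's measurable equivalence `B10Eq26MeasureInv.rot f` (no new
equivalence is declared; `rot_gauge_apply`: at `f b := R(u(b₋))` it IS r09's `B12ChiInvariance269.rotFluct` pointwise, `rfl`).
**`newTerm_onBonds_eq_of_covariant`** ∕ `newTerm_onBondsPrinted_eq_of_covariant` ∕ **`newTerm_onBonds_gauge_invariant`**: covariant
measures and jointly invariant `𝐏^{(k)}`, `{…}` give `𝐄^{(k+1)}(g, τU) = 𝐄^{(k+1)}(g, U)` with NO `χ_k` hypothesis — it is r09's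
`chiFluct_comp_local_isometry` ∕ `chiFluctPrinted_comp_local_isometry` (isometries preserve `|B′(b)|`).  HONEST NOTE: §8 lives on
the bond-field carrier with an abstract measure, §§4–7 on real coordinates `κ → ℝ` with the concrete Gaussian `gaussProb`; the
coordinate chart identifying the two (`VecField P k 𝔤 ≃ (ι → ℝ)`, `rot f ↦` a block-diagonal orthogonal matrix) is bookkeeping
owed nowhere and not written here (WRITTEN since: own leaf `B12Eq216GaussianCarrier`, gen 47).

v1.6 (gen 52, literature-prover-lit-balaban-r20-g52-0; DOCFIX-ONLY, every declaration byte-identical to v1.5 p368968 ✓ 146b2ed212f5):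
summit-lit1 g91 **P91-001** ∕ g98 P98-006 citation locators — (2.11) is the LAST display of [I] p. 267 [PDF 19], (2.12)–(2.14) are
p. 268 [PDF 20]: «(2.11)–(2.12) p.268» ×20 → «(2.11)–(2.12) pp.267–268», «(2.11)–(2.13) p.268» ×4 → «pp.267–268», «(2.11) p.268» ×5
→ «(2.11) p.267»; nothing else touched.
-/

namespace Literature.MathematicalPhysics.QuantumFieldTheory.Balaban1983to89.B12Eq213Body268

open Literature.MathematicalPhysics.QuantumFieldTheory.Balaban1983to89
open _root_.MeasureTheory
open Step Step.SFTower B12Eq019ActionBody B12Eq21Body265 B12Form13Step268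

noncomputable section

/-! ## §1. The fluctuation datum of the `k`-th step and (2.13) WITH BODY -/

/-- THE DATUM OF (2.12)/(2.13) AT STEP `k`, as parameters over a configuration type `X` (the background fields `U_{k+1}`):
the remaining fluctuation variables `B` (a measurable space `𝓑`), the Gaussian measures `dμ_{C^{(k)}(U_{k+1})}` (*«the measure
becomes a Gaussian measure in variables B, with the covariance C^{(k)} = C^{(k)}(U_{k+1})»* — a `U_{k+1}`-indexed family of
probability measures), the small-field characteristic function `χ_k` (values in `[0, 1]`, (2.9) p. 266), and the two parts of the
exponent named on p. 268: `𝐏^{(k)}(g_k, U_{k+1}, B)` and the curly bracket `{…}`.  Reader-chosen packaging; inhabiting it asserts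
nothing about Bałaban's objects. [cite: Balaban1987RG1, (2.12)–(2.13) p.268] -/
structure FluctData (X : Type*) where
  /-- the space of the remaining fluctuation variables `B` -/
  𝓑 : Type
  /-- its measurable structure -/
  m𝓑 : MeasurableSpace 𝓑
  /-- `U_{k+1} ↦ dμ_{C^{(k)}(U_{k+1})}`, the (normalised) Gaussian measures -/
  μ : X → Measure 𝓑
  /-- normalisation of each `dμ_{C^{(k)}(U_{k+1})}` -/
  prob : ∀ U, IsProbabilityMeasure (μ U)
  /-- the small-field characteristic function `χ_k` (it depends on `U_{k+1}` through `V^{(k)}`) -/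
  χ : X → 𝓑 → ℝ
  /-- `0 ≤ χ_k` -/
  χ_nonneg : ∀ U B, 0 ≤ χ U B
  /-- `χ_k ≤ 1` -/
  χ_le_one : ∀ U B, χ U B ≤ 1
  /-- `𝐏^{(k)}(g_k, U_{k+1}, B)` — *«connected with the expansion of the action −(1/g_k²)A(U_k(V)) and the measure in (2.1)»* -/
  P : ℝ → X → 𝓑 → ℝ
  /-- the curly bracket `{𝐄_k(U_k(exp i[g_kCB − hD̃(g_kCB)]V^{(k)})) − 𝐄_k(U_k(V^{(k)}))}` as a function of `(g_k, U_{k+1}, B)` -/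
  Q : ℝ → X → 𝓑 → ℝ

namespace FluctData

variable {X : Type*} (D : FluctData X)

/-- the measurable structure of the fluctuation variables, as an instance (plumbing). [folklore] -/
instance instMeasurableSpace𝓑 : MeasurableSpace D.𝓑 := D.m𝓑

/-- the normalisation of `dμ_{C^{(k)}(U)}`, as an instance (plumbing). [folklore] -/
instance instIsProbabilityMeasureμ (U : X) : IsProbabilityMeasure (D.μ U) := D.prob U

/-- *«The expression under the exponential»* of (2.12)/(2.13): `𝐏^{(k)}(g_k, U_{k+1}, B) + {…}`. [cite: Balaban1987RG1, (2.13) p.268] -/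
def exponent (g : ℝ) (U : X) (B : D.𝓑) : ℝ := D.P g U B + D.Q g U B

/-- `exponent D g U B = 𝐏(g, U, B) + {…}(g, U, B)`. [cite: Balaban1987RG1, (2.13) p.268] -/
theorem exponent_apply (g : ℝ) (U : X) (B : D.𝓑) : D.exponent g U B = D.P g U B + D.Q g U B := rfl

/-- The integrand of (2.13): `χ_k(B)·exp[𝐏^{(k)}(g_k, U_{k+1}, B) + {…}]`. [cite: Balaban1987RG1, (2.13) p.268] -/
def integrand (g : ℝ) (U : X) (B : D.𝓑) : ℝ := D.χ U B * Real.exp (D.exponent g U B)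

/-- `integrand D g U B = χ_U(B)·e^{exponent(g,U,B)}`. [cite: Balaban1987RG1, (2.13) p.268] -/
theorem integrand_apply (g : ℝ) (U : X) (B : D.𝓑) : D.integrand g U B = D.χ U B * Real.exp (D.exponent g U B) := rfl

/-- *«the integral above»*: `∫dμ_{C^{(k)}(U_{k+1})}(B) χ_k exp[𝐏^{(k)}(g_k, U_{k+1}, B) + {…}]`, a real number for each coupling `g_k`
and configuration `U_{k+1}`. [cite: Balaban1987RG1, (2.12)–(2.13) p.268] -/
def integral (g : ℝ) (U : X) : ℝ := ∫ B, D.integrand g U B ∂(D.μ U)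

/-- Unfolding of `integral`. [cite: Balaban1987RG1, (2.13) p.268] -/
theorem integral_def (g : ℝ) (U : X) :
    D.integral g U = ∫ B, D.χ U B * Real.exp (D.P g U B + D.Q g U B) ∂(D.μ U) := rfl

/-- **(2.13) WITH BODY — the new term of the inductive definition of the action `A_{k+1}`:**
`𝐄^{(k+1)}(g_k, U_{k+1}) := log ∫dμ_{C^{(k)}}(B) χ_k exp[𝐏^{(k)}(g_k, U_{k+1}, B) + {…}]`. [cite: Balaban1987RG1, (2.13) p.268] -/
def newTerm (g : ℝ) (U : X) : ℝ := Real.log (D.integral g U)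

/-- `𝐄^{(k+1)}(g, U) = log ∫ χ_U(B)·exp[𝐏(g,U,B) + {…}(g,U,B)] dμ_U(B)`. [cite: Balaban1987RG1, (2.13) p.268] -/
theorem newTerm_def (g : ℝ) (U : X) :
    D.newTerm g U = Real.log (∫ B, D.χ U B * Real.exp (D.P g U B + D.Q g U B) ∂(D.μ U)) := rfl

section NormConst
variable [One X]

/-- **The normalization constant `𝐍″_k`** of (2.12): *«the normalization constant 𝐍″_k is equal to the integral above at U_{k+1} = 1»*.
[cite: Balaban1987RG1, (2.12) p.268] -/
def normConst (g : ℝ) : ℝ := D.integral g 1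

/-- `𝐍″_k =` the integral of (2.12)/(2.13) at `U_{k+1} = 1`. [cite: Balaban1987RG1, (2.12) p.268] -/
theorem normConst_def (g : ℝ) : D.normConst g = D.integral g 1 := rfl

/-- **(2.14): `log 𝐍″_k = 𝐄^{(k+1)}(g_k, 1)`** — a theorem of the body (definitional). [cite: Balaban1987RG1, (2.14) p.268] -/
theorem log_normConst (g : ℝ) : Real.log (D.normConst g) = D.newTerm g 1 := rfl

end NormConst

/-! ### Elementary properties of the integral (no measurability hypotheses unless stated) -/

/-- The integrand is non-negative (`χ_k ≥ 0`, `exp > 0`). [cite: Balaban1987RG1, (2.13) p.268] -/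
theorem integrand_nonneg (g : ℝ) (U : X) (B : D.𝓑) : 0 ≤ D.integrand g U B :=
  mul_nonneg (D.χ_nonneg U B) (Real.exp_nonneg _)

/-- The integrand is at most `exp` of the exponent (`χ_k ≤ 1`). [cite: Balaban1987RG1, (2.13) p.268] -/
theorem integrand_le_exp (g : ℝ) (U : X) (B : D.𝓑) : D.integrand g U B ≤ Real.exp (D.exponent g U B) := by
  rw [integrand_apply]
  calc D.χ U B * Real.exp (D.exponent g U B) ≤ 1 * Real.exp (D.exponent g U B) :=
      mul_le_mul_of_nonneg_right (D.χ_le_one U B) (Real.exp_nonneg _)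
    _ = Real.exp (D.exponent g U B) := one_mul _

/-- The support of the integrand is the support of `χ_k` (`exp ≠ 0`). [cite: Balaban1987RG1, (2.13) p.268] -/
theorem support_integrand (g : ℝ) (U : X) : Function.support (D.integrand g U) = Function.support (D.χ U) := by
  ext B
  simp only [Function.mem_support, integrand_apply, ne_eq, mul_eq_zero, Real.exp_ne_zero, or_false]

/-- *«the integral above»* is non-negative (junk value `0` of a non-integrable integrand included). [cite: Balaban1987RG1, (2.13) p.268] -/
theorem integral_nonneg (g : ℝ) (U : X) : 0 ≤ D.integral g U :=
  MeasureTheory.integral_nonneg fun B => D.integrand_nonneg g U B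

/-- **Positivity of the integral**: for an integrable integrand, `∫ χ_k e^{…} dμ_U > 0` iff the small-field event has positive
`μ_U`-measure, `μ_U(supp χ_k) > 0`. [cite: Balaban1987RG1, (2.13) p.268] -/
theorem integral_pos_iff (g : ℝ) (U : X) (hint : Integrable (D.integrand g U) (D.μ U)) :
    0 < D.integral g U ↔ 0 < (D.μ U) (Function.support (D.χ U)) := by
  rw [integral, integral_pos_iff_support_of_nonneg_ae (Filter.Eventually.of_forall fun B => D.integrand_nonneg g U B) hint,
    support_integrand]

/-- If the exponent is `≤ M` on the support of `χ_k`, the integral is `≤ e^M` (probability measure, `0 ≤ χ_k ≤ 1`; no measurability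
needed). [cite: Balaban1987RG1, (2.13) p.268] -/
theorem integral_le_exp_of_le (g : ℝ) (U : X) {M : ℝ} (hM : ∀ B, D.χ U B ≠ 0 → D.exponent g U B ≤ M) :
    D.integral g U ≤ Real.exp M :=
  B16EflSup.integral_mul_exp_le_exp (D.μ U) (D.χ_nonneg U) (D.χ_le_one U) hM

/-- **`𝐄^{(k+1)}(g, U) ≤ M`** if the exponent is `≤ M` on the support of `χ_k` and `0 ≤ M` (the one-sided bound of the B16 lineage,
`B16EflSup.log_integral_mul_exp_le`, at every configuration). [cite: Balaban1987RG1, (2.13) p.268] -/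
theorem newTerm_le_of_supBound (g : ℝ) (U : X) {M : ℝ} (hM0 : 0 ≤ M) (hM : ∀ B, D.χ U B ≠ 0 → D.exponent g U B ≤ M) :
    D.newTerm g U ≤ M :=
  B16EflSup.log_integral_mul_exp_le (D.μ U) hM0 (D.χ_nonneg U) (D.χ_le_one U) hM

/-- The same for a positive integral, any sign of `M`. [cite: Balaban1987RG1, (2.13) p.268] -/
theorem newTerm_le_of_supBound_of_pos (g : ℝ) (U : X) {M : ℝ} (hpos : 0 < D.integral g U)
    (hM : ∀ B, D.χ U B ≠ 0 → D.exponent g U B ≤ M) : D.newTerm g U ≤ M :=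
  B16EflSup.log_integral_mul_exp_le_of_pos (D.μ U) hpos (D.χ_nonneg U) (D.χ_le_one U) hM

/-! ### *«the expression under the exponential above vanishes at g_k = 0»* — consequences for the body -/

/-- If the exponent vanishes identically at `(g, U)` (print: at `g_k = 0`), the new term is the logarithm of the `μ_U`-mass of `χ_k`:
`𝐄^{(k+1)}(g, U) = log ∫ χ_k dμ_U`. [cite: Balaban1987RG1, (2.13)–(2.14) p.268] -/
theorem newTerm_of_exponent_zero {g : ℝ} {U : X} (h : ∀ B, D.exponent g U B = 0) :
    D.newTerm g U = Real.log (∫ B, D.χ U B ∂(D.μ U)) := by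
  simp only [newTerm, integral, integrand_apply, h, Real.exp_zero, mul_one]

/-- If the exponent is `≤ 0` on the support of `χ_k` (in particular if it vanishes), then `∫ … ≤ 1` and `𝐄^{(k+1)}(g, U) ≤ 0`.
[cite: Balaban1987RG1, (2.13)–(2.14) p.268] -/
theorem newTerm_nonpos_of_exponent_nonpos {g : ℝ} {U : X} (h : ∀ B, D.χ U B ≠ 0 → D.exponent g U B ≤ 0) :
    D.newTerm g U ≤ 0 :=
  D.newTerm_le_of_supBound g U le_rfl h

/-- With `χ_k ≡ 1` and a vanishing exponent the new term is `0` (`∫ 1 dμ_U = 1` for a probability measure): the value of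
`𝐄^{(k+1)}(0, ·)` up to the small-field restriction. [cite: Balaban1987RG1, (2.13)–(2.14) p.268] -/
theorem newTerm_eq_zero_of_exponent_zero_of_chi_one {g : ℝ} {U : X} (h : ∀ B, D.exponent g U B = 0) (hχ : ∀ B, D.χ U B = 1) :
    D.newTerm g U = 0 := by
  rw [D.newTerm_of_exponent_zero h]
  simp [hχ]

/-! ### Steward bridge: the B16 lineage's carrier `B16EflSup.FluctuationIntegral` is this datum at one configuration -/

/-- The datum at coupling `g` and configuration `U` AS the carrier `B16EflSup.FluctuationIntegral` of the B16 lineage (same fields: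
the B-space, the normalised measure `dμ_{C^{(k)}(U)}`, `χ_k ∈ [0,1]`, the exponent `𝐏 + {…}` at `(g, U)`). [cite: Balaban1987RG1, (2.13)–(2.14) p.268] -/
def toFluct (g : ℝ) (U : X) : B16EflSup.FluctuationIntegral where
  Ω := D.𝓑
  mΩ := D.m𝓑
  μ := D.μ U
  prob := D.prob U
  χ := D.χ U
  χ_nonneg := D.χ_nonneg U
  χ_le_one := D.χ_le_one U
  F := D.exponent g U

/-- **`newTerm = FluctuationIntegral.E`** (definitional): the B16 lineage's constant `E = log ∫ χ e^F dμ` of the carrier IS (2.13) at the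
given configuration — no second functional is born. [cite: Balaban1987RG1, (2.13)–(2.14) p.268] -/
theorem newTerm_eq_E (g : ℝ) (U : X) : D.newTerm g U = (D.toFluct g U).E := rfl

/-- At `U_{k+1} = 1`: the B16 lineage's *«(2.13) at U_{k+1} = 1 … = log 𝐍″_k (2.14)»* constant is `log 𝐍″_k` of this file.
[cite: Balaban1987RG1, (2.14) p.268] -/
theorem log_normConst_eq_E [One X] (g : ℝ) : Real.log (D.normConst g) = (D.toFluct g 1).E := rfl

/-- The carrier's `SupBound M` is the sup-bound of the exponent on the support of `χ_k` at `(g, U)`. [cite: Balaban1987RG1, (2.13) p.268] -/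
theorem supBound_toFluct_iff (g : ℝ) (U : X) (M : ℝ) :
    (D.toFluct g U).SupBound M ↔ ∀ B, D.χ U B ≠ 0 → D.exponent g U B ≤ M := Iff.rfl

end FluctData

/-! ## §2. (2.12) WITH BODY over the tower `Step.SFTower` and the discharge of `h212` -/

section Eq212

variable {P : Params} {G : Type*} [GaugeGroup G] {Φ 𝒢 : Type*}

/-- **(2.12) WITH BODY — the right side of (2.12) as a function of the new background field `U = U_{k+1}`:**
`−(1/g_k²)A(U) + 𝐄_k(U) + [log Z^{(k)}(U) − log Z^{(k)}(1)] + log(𝐍″_k⁻¹ · ∫dμ_{C^{(k)}(U)}(B) χ_k exp[𝐏^{(k)}(g_k, U, B) + {…}])`,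
with `A = wilsonAction4` (print's `A`, `d = 4`), `𝐄_k = (1/g_k²)A + A_k` (p. 265, `B12Eq21Body265.EkOf`) at `A_k :=` the form (1.3)
`Step.SFTower.action13 T k`, `log Z^{(k)} = T.logZ k`, the couplings `g_k = T.flow.g k`, and the fluctuation datum `D` of step `k`.
[cite: Balaban1987RG1, (2.12) p.268] -/
def action212 (T : SFTower P G Φ 𝒢) (k : ℕ) (D : FluctData (GaugeField P 0 G)) (U : GaugeField P 0 G) : ℝ :=
  -(1 / (T.flow.g k) ^ 2) * wilsonAction4 U + EkOf (T.flow.g k) wilsonAction4 (T.action13 k) U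
    + (T.logZ k U - T.logZ k 1)
    + Real.log ((D.normConst (T.flow.g k))⁻¹ * D.integral (T.flow.g k) U)

/-- Unfolding of `action212`. [cite: Balaban1987RG1, (2.12) p.268] -/
theorem action212_def (T : SFTower P G Φ 𝒢) (k : ℕ) (D : FluctData (GaugeField P 0 G)) (U : GaugeField P 0 G) :
    action212 T k D U = -(1 / (T.flow.g k) ^ 2) * wilsonAction4 U + EkOf (T.flow.g k) wilsonAction4 (T.action13 k) U
      + (T.logZ k U - T.logZ k 1) + Real.log ((D.normConst (T.flow.g k))⁻¹ * D.integral (T.flow.g k) U) := rfl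

/-- THE FIRST LINE OF (2.12): `−(1/g_k²)A(U_{k+1}) + 𝐄_k(U_{k+1})` with `𝐄_k = (1/g_k²)A + A_k` IS `A_k`'s own expression read at the
new background field — here the form (1.3), `Step.SFTower.action13 T k U_{k+1}` (`B12Eq21Body265.repr_EkOf` pointwise).
[cite: Balaban1987RG1, (2.12) p.268, (2.1) p.265] -/
theorem action212_firstLine (gk : ℝ) (Ak : GaugeField P 0 G → ℝ) (U : GaugeField P 0 G) :
    -(1 / gk ^ 2) * wilsonAction4 U + EkOf gk wilsonAction4 Ak U = Ak U := by
  rw [EkOf_apply]; ring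

/-- (2.12) with its first line contracted: `action212 T k D U = A_k^{(1.3)}(U) + [log Z^{(k)}(U) − log Z^{(k)}(1)] + log(𝐍″_k⁻¹ · ∫…)`.
[cite: Balaban1987RG1, (2.12) p.268] -/
theorem action212_eq_log (T : SFTower P G Φ 𝒢) (k : ℕ) (D : FluctData (GaugeField P 0 G)) (U : GaugeField P 0 G) :
    action212 T k D U = T.action13 k U + (T.logZ k U - T.logZ k 1)
      + Real.log ((D.normConst (T.flow.g k))⁻¹ * D.integral (T.flow.g k) U) := by
  rw [action212_def, action212_firstLine]

/-- **`A_{k+1}(1) = 0` for the body of (2.12)** — every bracket vanishes at the trivial configuration: `A_k^{(1.3)}(1) = 0`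
(`B12Form13Step268.action13_one`), `log Z^{(k)}(1) − log Z^{(k)}(1) = 0`, and `log(𝐍″_k⁻¹ · 𝐍″_k) = 0` (unconditionally: `log 1 = 0`,
and Lean's `log 0 = 0` in the degenerate case `𝐍″_k = 0`).  Consistent with the normalization of (0.19) (`B12Eq019ActionBody.nextAction_one`).
[cite: Balaban1987RG1, (2.12) p.268, (0.19) p.255] -/
theorem action212_one (T : SFTower P G Φ 𝒢) (k : ℕ) (D : FluctData (GaugeField P 0 G)) :
    action212 T k D (1 : GaugeField P 0 G) = 0 := by
  rw [action212_eq_log, action13_one, sub_self, FluctData.normConst_def]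
  by_cases h : D.integral (T.flow.g k) 1 = 0
  · simp [h]
  · rw [inv_mul_cancel₀ h, Real.log_one]; simp

/-- **(2.12) WITH (2.13) AND (2.14) SUBSTITUTED**: whenever the integrals at `U` and at `1` (= `𝐍″_k`) are non-zero,
`action212 T k D U = A_k^{(1.3)}(U) + ([log Z^{(k)}(U) − log Z^{(k)}(1)] + [𝐄^{(k+1)}(g_k, U) − 𝐄^{(k+1)}(g_k, 1)])` with `𝐄^{(k+1)} =`
the body `FluctData.newTerm` — `log 𝐍″_k⁻¹∫… = log ∫… − log 𝐍″_k` and (2.14).  This is the shape `h212` of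
`B12Form13Step268.form13_succ_of_eq212`. [cite: Balaban1987RG1, (2.12)–(2.14) p.268] -/
theorem action212_eq (T : SFTower P G Φ 𝒢) (k : ℕ) (D : FluctData (GaugeField P 0 G)) (U : GaugeField P 0 G)
    (hN : D.normConst (T.flow.g k) ≠ 0) (hU : D.integral (T.flow.g k) U ≠ 0) :
    action212 T k D U = T.action13 k U
      + ((T.logZ k U - T.logZ k 1) + (D.newTerm (T.flow.g k) U - D.newTerm (T.flow.g k) 1)) := by
  rw [action212_eq_log, Real.log_mul (inv_ne_zero hN) hU, Real.log_inv, ← FluctData.log_normConst]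
  unfold FluctData.newTerm
  ring

/-- The same under POSITIVITY of the two integrals (the case of print: `χ_k ≥ 0` not a.e. zero, integrable integrand).
[cite: Balaban1987RG1, (2.12)–(2.14) p.268] -/
theorem action212_eq_of_pos (T : SFTower P G Φ 𝒢) (k : ℕ) (D : FluctData (GaugeField P 0 G)) (U : GaugeField P 0 G)
    (hN : 0 < D.normConst (T.flow.g k)) (hU : 0 < D.integral (T.flow.g k) U) :
    action212 T k D U = T.action13 k U
      + ((T.logZ k U - T.logZ k 1) + (D.newTerm (T.flow.g k) U - D.newTerm (T.flow.g k) 1)) :=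
  action212_eq T k D U hN.ne' hU.ne'

/-- **The exponentiated step**: under positivity, `exp A_{k+1}(U) = exp(A_k^{(1.3)}(U) + [log Z^{(k)}(U) − log Z^{(k)}(1)]) · 𝐍″_k⁻¹ · ∫dμ_{C^{(k)}(U)} χ_k e^{𝐏 + {…}}`
for the body of (2.12). [cite: Balaban1987RG1, (2.12) p.268] -/
theorem exp_action212 (T : SFTower P G Φ 𝒢) (k : ℕ) (D : FluctData (GaugeField P 0 G)) (U : GaugeField P 0 G)
    (hN : 0 < D.normConst (T.flow.g k)) (hU : 0 < D.integral (T.flow.g k) U) :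
    Real.exp (action212 T k D U)
      = Real.exp (T.action13 k U + (T.logZ k U - T.logZ k 1)) * ((D.normConst (T.flow.g k))⁻¹ * D.integral (T.flow.g k) U) := by
  rw [action212_eq_log, Real.exp_add, Real.exp_log (mul_pos (inv_pos.mpr hN) hU)]

/-- **THE FORM (1.3) ADVANCES THROUGH THE BODY OF (2.12)** — print p. 268: *«The equalities (2.12), (2.14) together with the definitions
(2.13), (2.15) imply that the action A_{k+1} is given by (1.3) with k+1 instead of k.»*  For any parametrization `U` of the background
fields `U_{k+1}(V)` on a domain `dom` and any candidate action `A′ = A_{k+1}`: IF on `dom` the action is given by the BODY of (2.12)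
(`h212`), the two integrals do not vanish there, (2.15) holds (`hrg`), and the tower's `(k+1)`-st total term is the body (2.13) on `dom`
and at `1` (`hdef`, `hdef1` — print's *«The integral in (2.12) defines the new term 𝐄^{(k+1)} in the inductive definition of the action
A_{k+1} by the formula (2.13)»*), THEN `A′(V) = A_{k+1}^{(1.3)}(U_{k+1}(V))` on `dom`.  This is r09's `B12Form13Step268.form13_succ_of_eq212`
with its hypothesis `h212` DISCHARGED by `action212_eq`. [cite: Balaban1987RG1, (2.12)–(2.15) p.268] -/
theorem form13_succ_of_action212 (T : SFTower P G Φ 𝒢) (k : ℕ) (D : FluctData (GaugeField P 0 G)) {Y : Type*} (dom : Set Y)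
    (U : Y → GaugeField P 0 G) (A' : Y → ℝ)
    (hrg : 1 / (T.flow.g k) ^ 2 = 1 / (T.flow.g (k+1)) ^ 2 + T.flow.β (k+1) (T.flow.g k))
    (hdef : ∀ V ∈ dom, (T.Etot (k+1) (T.flow.g k) (T.ofBackground (U V))).re = D.newTerm (T.flow.g k) (U V))
    (hdef1 : (T.Etot (k+1) (T.flow.g k) (T.ofBackground 1)).re = D.newTerm (T.flow.g k) 1)
    (hN : D.normConst (T.flow.g k) ≠ 0) (hne : ∀ V ∈ dom, D.integral (T.flow.g k) (U V) ≠ 0)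
    (h212 : ∀ V ∈ dom, A' V = action212 T k D (U V)) :
    ∀ V ∈ dom, A' V = T.action13 (k+1) (U V) :=
  form13_succ_of_eq212 T k dom U A' hrg fun V hV => by
    rw [h212 V hV, action212_eq T k D (U V) hN (hne V hV), hdef V hV, hdef1]

/-- The same at the cell's background record (`Setup.Background`: domains `bg.dom j`, background maps `bg.U j`) for a sequence of
actions `A`: the `form13` clause of `Step.GeneratedBySmallFieldRT` AT THE NEXT INDEX `k+1` from the body of (2.12) at index `k`.
[cite: Balaban1987RG1, (2.12)–(2.15) p.268, (1.3) p.260] -/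
theorem form13_succ_of_action212_background (T : SFTower P G Φ 𝒢) {av : ∀ j, Averaging P j G} (bg : Background P G av)
    (A : ∀ j, Density P j G) (k : ℕ) (D : FluctData (GaugeField P 0 G))
    (hrg : 1 / (T.flow.g k) ^ 2 = 1 / (T.flow.g (k+1)) ^ 2 + T.flow.β (k+1) (T.flow.g k))
    (hdef : ∀ V ∈ bg.dom (k+1), (T.Etot (k+1) (T.flow.g k) (T.ofBackground (bg.U (k+1) V))).re = D.newTerm (T.flow.g k) (bg.U (k+1) V))
    (hdef1 : (T.Etot (k+1) (T.flow.g k) (T.ofBackground 1)).re = D.newTerm (T.flow.g k) 1)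
    (hN : D.normConst (T.flow.g k) ≠ 0) (hne : ∀ V ∈ bg.dom (k+1), D.integral (T.flow.g k) (bg.U (k+1) V) ≠ 0)
    (h212 : ∀ V ∈ bg.dom (k+1), A (k+1) V = action212 T k D (bg.U (k+1) V)) :
    ∀ V ∈ bg.dom (k+1), A (k+1) V = T.action13 (k+1) (bg.U (k+1) V) :=
  form13_succ_of_action212 T k D (bg.dom (k+1)) (bg.U (k+1)) (A (k+1)) hrg hdef hdef1 hN hne h212

/-- **(2.12) as an equation for the body (0.19)**: if the `(k+1)`-st action IS `B12Eq019ActionBody.nextAction T_k χ_k 𝐆 g_k A_k` (the body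
of (0.19)/(2.1)) and print's equation (2.12) holds for it on the small-field domain — `nextAction … V = action212 T k D (U_{k+1}(V))`, the
§2 computation (2.2)–(2.11), a HYPOTHESIS here —, then under (2.15) and the definitional sentence of (2.13) the new action has the form
(1.3) at `k+1` there. [cite: Balaban1987RG1, (2.12)–(2.15) p.268, (0.19) p.255] -/
theorem form13_succ_of_nextAction_eq_action212 (T : SFTower P G Φ 𝒢) (k : ℕ) (D : FluctData (GaugeField P 0 G))
    (Tk : Density P k G → Density P (k+1) G) (χ GF Ak : Density P k G) (dom : Set (GaugeField P (k+1) G))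
    (U : GaugeField P (k+1) G → GaugeField P 0 G)
    (hrg : 1 / (T.flow.g k) ^ 2 = 1 / (T.flow.g (k+1)) ^ 2 + T.flow.β (k+1) (T.flow.g k))
    (hdef : ∀ V ∈ dom, (T.Etot (k+1) (T.flow.g k) (T.ofBackground (U V))).re = D.newTerm (T.flow.g k) (U V))
    (hdef1 : (T.Etot (k+1) (T.flow.g k) (T.ofBackground 1)).re = D.newTerm (T.flow.g k) 1)
    (hN : D.normConst (T.flow.g k) ≠ 0) (hne : ∀ V ∈ dom, D.integral (T.flow.g k) (U V) ≠ 0)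
    (h212 : ∀ V ∈ dom, nextAction Tk χ GF (T.flow.g k) Ak V = action212 T k D (U V)) :
    ∀ V ∈ dom, nextAction Tk χ GF (T.flow.g k) Ak V = T.action13 (k+1) (U V) :=
  form13_succ_of_action212 T k D dom U (nextAction Tk χ GF (T.flow.g k) Ak) hrg hdef hdef1 hN hne h212

/-- ALONG A FLOW satisfying (0.20)/(2.15) up to `K` (`Flow.SatisfiesRG`): at every step `k < K`, the body of (2.12) with non-vanishing
integrals and the definitional sentence of (2.13) give the form (1.3) at `k+1`. [cite: Balaban1987RG1, (2.12)–(2.15) p.268, (0.20) p.256] -/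
theorem form13_succ_of_action212_of_satisfiesRG (T : SFTower P G Φ 𝒢) {K : ℕ} (hRG : T.flow.SatisfiesRG K) {k : ℕ} (hk : k < K)
    (D : FluctData (GaugeField P 0 G)) {Y : Type*} (dom : Set Y) (U : Y → GaugeField P 0 G) (A' : Y → ℝ)
    (hdef : ∀ V ∈ dom, (T.Etot (k+1) (T.flow.g k) (T.ofBackground (U V))).re = D.newTerm (T.flow.g k) (U V))
    (hdef1 : (T.Etot (k+1) (T.flow.g k) (T.ofBackground 1)).re = D.newTerm (T.flow.g k) 1)
    (hN : D.normConst (T.flow.g k) ≠ 0) (hne : ∀ V ∈ dom, D.integral (T.flow.g k) (U V) ≠ 0)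
    (h212 : ∀ V ∈ dom, A' V = action212 T k D (U V)) :
    ∀ V ∈ dom, A' V = T.action13 (k+1) (U V) :=
  form13_succ_of_action212 T k D dom U A' (hRG k hk) hdef hdef1 hN hne h212

/-- The new bracket of (1.3) produced by the step, read through the body: under the definitional sentence of (2.13), the tower's
vacuum-subtracted `(k+1)`-st term `Re 𝐄^{(k+1)}(g_k, U) − Re 𝐄^{(k+1)}(g_k, 1)` is `newTerm(g_k, U) − log 𝐍″_k` ((2.14)).
[cite: Balaban1987RG1, (2.13)–(2.14) p.268] -/
theorem newBracket_eq (T : SFTower P G Φ 𝒢) (k : ℕ) (D : FluctData (GaugeField P 0 G)) (U : GaugeField P 0 G)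
    (hdef : (T.Etot (k+1) (T.flow.g k) (T.ofBackground U)).re = D.newTerm (T.flow.g k) U)
    (hdef1 : (T.Etot (k+1) (T.flow.g k) (T.ofBackground 1)).re = D.newTerm (T.flow.g k) 1) :
    (T.Etot (k+1) (T.flow.g k) (T.ofBackground U)).re - (T.Etot (k+1) (T.flow.g k) (T.ofBackground 1)).re
      = D.newTerm (T.flow.g k) U - Real.log (D.normConst (T.flow.g k)) := by
  rw [hdef, hdef1, FluctData.log_normConst]

end Eq212

/-! ## §3. p. 269: invariance of the body under a covariant change of variables — the mechanism of (2.16)–(2.18) (v1.1) -/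

namespace FluctData

variable {X : Type*} (D : FluctData X)

/-- Joint invariance of the two named parts `𝐏^{(k)}`, `{…}` gives joint invariance of *«the expression under the exponential»*.
[cite: Balaban1987RG1, (2.16) p.269] -/
theorem exponent_eq_of_covariant (g : ℝ) (τ : X → X) (e : D.𝓑 ≃ᵐ D.𝓑)
    (hP : ∀ U B, D.P g (τ U) (e B) = D.P g U B) (hQ : ∀ U B, D.Q g (τ U) (e B) = D.Q g U B) (U : X) (B : D.𝓑) :
    D.exponent g (τ U) (e B) = D.exponent g U B := by
  rw [exponent_apply, exponent_apply, hP, hQ]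

/-- **THE MECHANISM OF (2.16)–(2.18) FOR *«the integral above»***: if the measures are covariant under a background map `τ`
and a measurable equivalence `e` of the fluctuation variables — `(dμ_{C^{(k)}(U)}).map e = dμ_{C^{(k)}(τU)}` (*«together with the
measure, are invariant»*) —, the characteristic function is jointly invariant (*«The characteristic function is invariant with
respect to the transformations of the fluctuation field»*) and so is the exponent (*«all the expressions in (2.12) … are
invariant»*), then `∫dμ_{τU} χ_k e^{…}(τU, ·) = ∫dμ_U χ_k e^{…}(U, ·)` — by the change of variables `B ↦ e B`
(`MeasureTheory.integral_map_equiv`; the B10 twin of this sentence is `B10Eq26MeasureInv.integral_eq_of_cov`). [cite: Balaban1987RG1, (2.16) p.269] -/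
theorem integral_eq_of_covariant (g : ℝ) (τ : X → X) (e : D.𝓑 ≃ᵐ D.𝓑)
    (hμ : ∀ U, (D.μ U).map e = D.μ (τ U)) (hχ : ∀ U B, D.χ (τ U) (e B) = D.χ U B)
    (hexp : ∀ U B, D.exponent g (τ U) (e B) = D.exponent g U B) (U : X) :
    D.integral g (τ U) = D.integral g U := by
  rw [integral, integral, ← hμ U, integral_map_equiv]
  simp only [integrand_apply, hχ, hexp]

/-- **«therefore the expression (2.13) is gauge invariant»** (and Euclidean invariant, (2.17)–(2.18), *«for the same reasons»*):
under the three covariances the body (2.13) satisfies `𝐄^{(k+1)}(g, τU) = 𝐄^{(k+1)}(g, U)`. [cite: Balaban1987RG1, (2.16)–(2.18) p.269] -/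
theorem newTerm_eq_of_covariant (g : ℝ) (τ : X → X) (e : D.𝓑 ≃ᵐ D.𝓑)
    (hμ : ∀ U, (D.μ U).map e = D.μ (τ U)) (hχ : ∀ U B, D.χ (τ U) (e B) = D.χ U B)
    (hexp : ∀ U B, D.exponent g (τ U) (e B) = D.exponent g U B) (U : X) :
    D.newTerm g (τ U) = D.newTerm g U := by
  rw [newTerm, newTerm, D.integral_eq_of_covariant g τ e hμ hχ hexp U]

/-- The same with the exponent's invariance supplied part by part (`𝐏^{(k)}` and `{…}` separately). [cite: Balaban1987RG1, (2.16) p.269] -/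
theorem newTerm_eq_of_covariant_parts (g : ℝ) (τ : X → X) (e : D.𝓑 ≃ᵐ D.𝓑)
    (hμ : ∀ U, (D.μ U).map e = D.μ (τ U)) (hχ : ∀ U B, D.χ (τ U) (e B) = D.χ U B)
    (hP : ∀ U B, D.P g (τ U) (e B) = D.P g U B) (hQ : ∀ U B, D.Q g (τ U) (e B) = D.Q g U B) (U : X) :
    D.newTerm g (τ U) = D.newTerm g U :=
  D.newTerm_eq_of_covariant g τ e hμ hχ (D.exponent_eq_of_covariant g τ e hP hQ) U

/-- Invariance along the iterates of `τ` (e.g. a one-parameter family of gauge transformations applied repeatedly):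
`𝐄^{(k+1)}(g, τ^[n] U) = 𝐄^{(k+1)}(g, U)`. [cite: Balaban1987RG1, (2.16) p.269] -/
theorem newTerm_iterate_eq_of_covariant (g : ℝ) (τ : X → X) (e : D.𝓑 ≃ᵐ D.𝓑)
    (hμ : ∀ U, (D.μ U).map e = D.μ (τ U)) (hχ : ∀ U B, D.χ (τ U) (e B) = D.χ U B)
    (hexp : ∀ U B, D.exponent g (τ U) (e B) = D.exponent g U B) (n : ℕ) (U : X) :
    D.newTerm g (τ^[n] U) = D.newTerm g U := by
  induction n generalizing U with
  | zero => rfl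
  | succ n ih => rw [Function.iterate_succ_apply', D.newTerm_eq_of_covariant g τ e hμ hχ hexp, ih]

end FluctData

section Eq216

variable {P : Params} {G : Type*} [GaugeGroup G] {Φ 𝒢 : Type*}

/-- **ALL OF (2.12) IS INVARIANT** (p. 269): if the first line `A_k^{(1.3)}` and the bracket `log Z^{(k)}` are invariant under the
background map `τ` (*«all the expressions in (2.12) … are invariant»* — for `U ↦ U^u` these are (1.19) at the levels `≤ k` and the
gauge invariance of (1.4)), and the fluctuation datum is covariant under `(τ, e)` as in `FluctData.integral_eq_of_covariant`, then
the body of (2.12) satisfies `A_{k+1}(τU) = A_{k+1}(U)` (the constant `𝐍″_k` is untouched). [cite: Balaban1987RG1, (2.16) p.269] -/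
theorem action212_eq_of_covariant (T : SFTower P G Φ 𝒢) (k : ℕ) (D : FluctData (GaugeField P 0 G))
    (τ : GaugeField P 0 G → GaugeField P 0 G) (e : D.𝓑 ≃ᵐ D.𝓑)
    (hμ : ∀ U, (D.μ U).map e = D.μ (τ U)) (hχ : ∀ U B, D.χ (τ U) (e B) = D.χ U B)
    (hexp : ∀ U B, D.exponent (T.flow.g k) (τ U) (e B) = D.exponent (T.flow.g k) U B)
    (h13 : ∀ U, T.action13 k (τ U) = T.action13 k U) (hZ : ∀ U, T.logZ k (τ U) = T.logZ k U) (U : GaugeField P 0 G) :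
    action212 T k D (τ U) = action212 T k D U := by
  rw [action212_eq_log, action212_eq_log, h13, hZ, D.integral_eq_of_covariant (T.flow.g k) τ e hμ hχ hexp U]

/-- In particular the DIFFERENCE `A_{k+1}(τU) − A_{k+1}(U)` of the body of (2.12) is the difference of the first lines plus that of
the `Z^{(k)}`-brackets once the datum is covariant: the fluctuation integral contributes nothing. [cite: Balaban1987RG1, (2.16) p.269] -/
theorem action212_sub_eq_of_covariant (T : SFTower P G Φ 𝒢) (k : ℕ) (D : FluctData (GaugeField P 0 G))
    (τ : GaugeField P 0 G → GaugeField P 0 G) (e : D.𝓑 ≃ᵐ D.𝓑)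
    (hμ : ∀ U, (D.μ U).map e = D.μ (τ U)) (hχ : ∀ U B, D.χ (τ U) (e B) = D.χ U B)
    (hexp : ∀ U B, D.exponent (T.flow.g k) (τ U) (e B) = D.exponent (T.flow.g k) U B) (U : GaugeField P 0 G) :
    action212 T k D (τ U) - action212 T k D U
      = (T.action13 k (τ U) - T.action13 k U) + (T.logZ k (τ U) - T.logZ k U) := by
  rw [action212_eq_log, action212_eq_log, D.integral_eq_of_covariant (T.flow.g k) τ e hμ hχ hexp U]
  ring

end Eq216

/-! ## §4. p. 268: the measure clause WITH BODY — `dμ_{C^{(k)}(U)}` = the normalised Gaussian at precision `C*Δ^{(k)}(U)C` (v1.2) -/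

section GaussianDatum

open ProbabilityTheory
open scoped Matrix

/-- **PRINT'S PRECISION after the elimination `B′ = CB`**: the quadratic form `½⟨B′, Δ^{(k)}(U)B′⟩` of (2.11) at `B′ = CB` is
`½⟨B, (C*Δ^{(k)}(U)C)B⟩`; its matrix `C*Δ^{(k)}(U)C` (`C* = Cᵀ`, real variables), whose INVERSE is print's covariance
`C^{(k)}(U) = (C*Δ^{(k)}C)⁻¹`.  `Cop : Matrix ι κ ℝ` maps the remaining variables (`κ`) to all variables (`ι`); `Δ U` is `Δ^{(k)}(U)`.
[cite: Balaban1987RG1, (2.11)–(2.12) pp.267–268] -/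
def prec212 {X : Type*} {ι κ : Type*} [Fintype ι] (Cop : Matrix ι κ ℝ) (Δ : X → Matrix ι ι ℝ) (U : X) : Matrix κ κ ℝ :=
  Cop.transpose * Δ U * Cop

/-- `prec212 Cop Δ U = Cᵀ · Δ(U) · C`. [cite: Balaban1987RG1, (2.11)–(2.12) pp.267–268] -/
theorem prec212_def {X : Type*} {ι κ : Type*} [Fintype ι] (Cop : Matrix ι κ ℝ) (Δ : X → Matrix ι ι ℝ) (U : X) :
    prec212 Cop Δ U = Cop.transpose * Δ U * Cop := rfl

/-- **«B′ = CB»** in the quadratic form: `⟨B, (CᵀΔC)B⟩ = ⟨CB, Δ(CB)⟩`. [cite: Balaban1987RG1, (2.11)–(2.12) pp.267–268] -/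
theorem quadForm_prec212 {X : Type*} {ι κ : Type*} [Fintype ι] [Fintype κ] (Cop : Matrix ι κ ℝ) (Δ : X → Matrix ι ι ℝ)
    (U : X) (B : κ → ℝ) :
    B ⬝ᵥ (prec212 Cop Δ U *ᵥ B) = (Cop *ᵥ B) ⬝ᵥ (Δ U *ᵥ (Cop *ᵥ B)) := by
  rw [prec212_def, ← Matrix.mulVec_mulVec, ← Matrix.mulVec_mulVec, Matrix.dotProduct_mulVec, Matrix.vecMul_transpose]

/-- The precision `C*Δ^{(k)}(U)C` is positive definite when `Δ^{(k)}(U)` is and the elimination map `C` is injective (as it is: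
`B′ = CB` parametrises the solutions of `Q̃B′ = 0` by the remaining variables).  Mathlib `Matrix.PosDef.conjTranspose_mul_mul_same`.
[cite: Balaban1987RG1, (2.11)–(2.12) pp.267–268] -/
theorem posDef_prec212 {X : Type*} {ι κ : Type*} [Fintype ι] [Fintype κ] [DecidableEq ι] [DecidableEq κ] (Cop : Matrix ι κ ℝ)
    (Δ : X → Matrix ι ι ℝ) (U : X) (hΔ : (Δ U).PosDef) (hC : Function.Injective Cop.mulVec) :
    (prec212 Cop Δ U).PosDef := by
  have h := hΔ.conjTranspose_mul_mul_same hC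
  rwa [Matrix.conjTranspose_eq_transpose_of_trivial] at h

variable {X : Type*} {κ : Type} [Fintype κ] [DecidableEq κ]

/-- **The coordinates of `B` under the tree's normalised Gaussian `gaussProb M` have covariance matrix `M⁻¹`** (for `M` positive
definite): `cov[B(a), B(b); dμ_{M⁻¹}] = (M⁻¹)_{ab}` — Mathlib's `covariance_eval_multivariateGaussian` transported through
`B2Eq228Conditioning.gaussProb_eq_map_multivariateGaussian` (the coordinate image of `multivariateGaussian 0 M⁻¹`).  The sentence
*«a Gaussian measure in variables B, with the covariance …»* read literally. [cite: Balaban1987RG1, (2.11)–(2.12) pp.267–268] -/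
theorem covariance_gaussProb {M : Matrix κ κ ℝ} (hM : M.PosDef) (a b : κ) :
    cov[fun B : κ → ℝ => B a, fun B => B b; B2Eq228Conditioning.gaussProb M] = M⁻¹ a b := by
  rw [B2Eq228Conditioning.gaussProb_eq_map_multivariateGaussian hM, covariance_map_equiv]
  have ha : (fun B : κ → ℝ => B a) ∘ ⇑(MeasurableEquiv.toLp 2 (κ → ℝ)).symm = fun x : EuclideanSpace ℝ κ => x a := by
    funext x; rfl
  have hb : (fun B : κ → ℝ => B b) ∘ ⇑(MeasurableEquiv.toLp 2 (κ → ℝ)).symm = fun x : EuclideanSpace ℝ κ => x b := by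
    funext x; rfl
  rw [ha, hb, covariance_eval_multivariateGaussian hM.inv.posSemidef]

namespace FluctData

/-- **THE MEASURE CLAUSE WITH BODY**: the datum of (2.12)/(2.13) whose measures are the tree's normalised Gaussians
`dμ_{C^{(k)}(U)} := B2Eq228Conditioning.gaussProb (prec U)` on the remaining variables `B : κ → ℝ` (*«the measure becomes a Gaussian measure in
variables B, with the covariance C^{(k)} = C^{(k)}(U_{k+1})»*, precision `prec U = (C^{(k)}(U))⁻¹`, positive definite), with the
characteristic function `χ_k` and the exponent parts `𝐏^{(k)}`, `{…}` as before. [cite: Balaban1987RG1, (2.11)–(2.13) pp.267–268] -/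
def gaussian (prec : X → Matrix κ κ ℝ) (hpd : ∀ U, (prec U).PosDef) (χ : X → (κ → ℝ) → ℝ) (h0 : ∀ U B, 0 ≤ χ U B)
    (h1 : ∀ U B, χ U B ≤ 1) (P Q : ℝ → X → (κ → ℝ) → ℝ) : FluctData X where
  𝓑 := κ → ℝ
  m𝓑 := inferInstance
  μ := fun U => B2Eq228Conditioning.gaussProb (prec U)
  prob := fun U => B2Eq228Conditioning.isProbabilityMeasure_gaussProb (hpd U)
  χ := χ
  χ_nonneg := h0
  χ_le_one := h1
  P := P
  Q := Q

variable (prec : X → Matrix κ κ ℝ) (hpd : ∀ U, (prec U).PosDef) (χ : X → (κ → ℝ) → ℝ) (h0 : ∀ U B, 0 ≤ χ U B)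
  (h1 : ∀ U B, χ U B ≤ 1) (P Q : ℝ → X → (κ → ℝ) → ℝ)

/-- The measures of the Gaussian datum are `gaussProb (prec U)` (definitional). [cite: Balaban1987RG1, (2.11)–(2.12) pp.267–268] -/
theorem gaussian_μ (U : X) : (gaussian prec hpd χ h0 h1 P Q).μ U = B2Eq228Conditioning.gaussProb (prec U) := rfl

/-- **(2.13) at the Gaussian datum, unfolded to Lebesgue form**: *«the integral above»* is
`(∫dB e^{−½⟨B, M_U B⟩})⁻¹ · ∫dB e^{−½⟨B, M_U B⟩} χ_k(B) e^{𝐏^{(k)}(g,U,B) + {…}(g,U,B)}`, `M_U = prec U`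
(`B2Eq228Conditioning.integral_gaussProb_eq` by name). [cite: Balaban1987RG1, (2.12)–(2.13) p.268] -/
theorem integral_gaussian_eq (g : ℝ) (U : X) :
    (gaussian prec hpd χ h0 h1 P Q).integral g U
      = (B13GaugeDevices.gaussNorm (prec U))⁻¹ * ∫ B, B13GaugeDevices.gaussWeight (prec U) B * (χ U B * Real.exp (P g U B + Q g U B)) := by
  rw [integral_def]
  exact B2Eq228Conditioning.integral_gaussProb_eq (prec U) _

/-- **The Gaussian normalisation separates as a logarithmic bracket**: when the unnormalised integral does not vanish,
`𝐄^{(k+1)}(g, U) = log ∫dB e^{−½⟨B, M_U B⟩} χ_k e^{𝐏+{…}} − log ∫dB e^{−½⟨B, M_U B⟩}` — the mechanism by which (2.12) carries the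
normalisations `Z^{(k)}` of (1.4) as the separate bracket `[log Z^{(k)}(U_{k+1}) − log Z^{(k)}(1)]` (the identification of `Z^{(k)}(U)`
with `∫e^{−½⟨B,(C*Δ^{(k)}(U)C)B⟩}` up to the elimination Jacobian is NOT asserted here). [cite: Balaban1987RG1, (2.12)–(2.13) p.268, (1.4) p.260] -/
theorem newTerm_gaussian_eq (g : ℝ) (U : X)
    (hI : ∫ B, B13GaugeDevices.gaussWeight (prec U) B * (χ U B * Real.exp (P g U B + Q g U B)) ≠ 0) :
    (gaussian prec hpd χ h0 h1 P Q).newTerm g U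
      = Real.log (∫ B, B13GaugeDevices.gaussWeight (prec U) B * (χ U B * Real.exp (P g U B + Q g U B)))
        - Real.log (B13GaugeDevices.gaussNorm (prec U)) := by
  rw [newTerm, integral_gaussian_eq, Real.log_mul (inv_ne_zero (B2Eq228Conditioning.gaussNorm_pos (hpd U)).ne') hI, Real.log_inv]
  ring

/-- **PRINT'S COVARIANCE SENTENCE as a theorem**: under the Gaussian datum the fluctuation variables have covariance matrix
`(prec U)⁻¹` — `cov[B(a), B(b); dμ_{C^{(k)}(U)}] = ((prec U)⁻¹)_{ab}`. [cite: Balaban1987RG1, (2.11)–(2.12) pp.267–268] -/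
theorem covariance_gaussian (U : X) (a b : κ) :
    cov[fun B : κ → ℝ => B a, fun B => B b; (gaussian prec hpd χ h0 h1 P Q).μ U] = (prec U)⁻¹ a b := by
  rw [gaussian_μ]
  exact covariance_gaussProb (hpd U) a b

/-- **«with the covariance C^{(k)} = C^{(k)}(U_{k+1}) = (C*Δ^{(k)}C)⁻¹»**: at print's precision `prec212 Cop Δ` (positive definite
under `posDef_prec212`'s hypotheses) the covariance matrix of `B` under `dμ_{C^{(k)}(U)}` is `(CᵀΔ^{(k)}(U)C)⁻¹`.
[cite: Balaban1987RG1, (2.11)–(2.12) pp.267–268] -/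
theorem covariance_gaussian_prec212 {ι : Type*} [Fintype ι] (Cop : Matrix ι κ ℝ) (Δ : X → Matrix ι ι ℝ)
    (hpd : ∀ U, (prec212 Cop Δ U).PosDef) (U : X) (a b : κ) :
    cov[fun B : κ → ℝ => B a, fun B => B b; (gaussian (prec212 Cop Δ) hpd χ h0 h1 P Q).μ U]
      = (Cop.transpose * Δ U * Cop)⁻¹ a b :=
  covariance_gaussian (prec212 Cop Δ) hpd χ h0 h1 P Q U a b

end FluctData

end GaussianDatum

/-! ## §5. p. 269 (2.16) for the GAUSSIAN datum: the measure clause `hμ` of §3 DISCHARGED by `B12Eq216MeasureCovariance` (v1.3) -/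

section GaussianCovariant

open scoped Matrix

variable {X : Type*} {κ : Type} [Fintype κ]

/-- **Print's transformations act on the field `B′`; on the remaining variables `B` (`B′ = CB`) they act by `R₂` with the
elimination map intertwining, `C R₂ = R₁ C`.**  A function of `B′` invariant under `B′ ↦ R₁B′` (jointly with the background map
`τ`) is, read at `B′ = CB`, invariant under `B ↦ R₂B`: `F(τU, C(R₂B)) = F(U, CB)`. [cite: Balaban1987RG1, (2.16) p.269 with (2.11)–(2.12) pp.267–268] -/
theorem pullback_invariant_of_intertwine {ι : Type*} [Fintype ι] {β : Type*} (Cop : Matrix ι κ ℝ) (R₁ : Matrix ι ι ℝ)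
    (R₂ : Matrix κ κ ℝ) (hC : Cop * R₂ = R₁ * Cop) {τ : X → X} (F : X → (ι → ℝ) → β)
    (hF : ∀ U B', F (τ U) (R₁ *ᵥ B') = F U B') (U : X) (B : κ → ℝ) :
    F (τ U) (Cop *ᵥ (R₂ *ᵥ B)) = F U (Cop *ᵥ B) := by
  rw [Matrix.mulVec_mulVec, hC, ← Matrix.mulVec_mulVec, hF]

variable [DecidableEq κ]

namespace FluctData

variable (prec : X → Matrix κ κ ℝ) (hpd : ∀ U, (prec U).PosDef) (χ : X → (κ → ℝ) → ℝ) (h0 : ∀ U B, 0 ≤ χ U B)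
  (h1 : ∀ U B, χ U B ≤ 1) (P Q : ℝ → X → (κ → ℝ) → ℝ)

/-- **«together with the measure, are invariant» FOR THE GAUSSIAN DATUM — the hypothesis `hμ` of `integral_eq_of_covariant`
DISCHARGED:** if the precision is conjugated by the orthogonal `R` under the background map `τ`, `prec(τU) = R·prec(U)·Rᵀ`, then
`(dμ_{C^{(k)}(U)}).map (B ↦ RB) = dμ_{C^{(k)}(τU)}` for `dμ_{C^{(k)}(U)} = gaussProb (prec U)` — r09's
`B12Eq216MeasureCovariance.gaussProb_map_covariant` by name, `e := B12Eq216MeasureCovariance.rotEquiv R hR`. [cite: Balaban1987RG1, (2.16) p.269] -/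
theorem gaussian_map_rotEquiv (R : Matrix κ κ ℝ) (hR : Rᵀ * R = 1) (τ : X → X)
    (hprec : ∀ U, prec (τ U) = R * prec U * Rᵀ) (U : X) :
    ((gaussian prec hpd χ h0 h1 P Q).μ U).map ⇑(B12Eq216MeasureCovariance.rotEquiv R hR) = (gaussian prec hpd χ h0 h1 P Q).μ (τ U) :=
  B12Eq216MeasureCovariance.gaussProb_map_covariant R hR hprec U

/-- *«the integral above»* of the Gaussian datum is an invariant function of the background: `∫dμ_{τU} χ_k e^{𝐏+{…}}(τU, ·) =
∫dμ_U χ_k e^{𝐏+{…}}(U, ·)` as soon as the precision is covariant and `χ_k`, `𝐏^{(k)}`, `{…}` are jointly invariant under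
`(U, B) ↦ (τU, RB)` (§3's mechanism with `hμ` discharged). [cite: Balaban1987RG1, (2.16) p.269] -/
theorem integral_gaussian_eq_of_covariant (g : ℝ) (R : Matrix κ κ ℝ) (hR : Rᵀ * R = 1) (τ : X → X)
    (hprec : ∀ U, prec (τ U) = R * prec U * Rᵀ) (hχ : ∀ U B, χ (τ U) (R *ᵥ B) = χ U B)
    (hP : ∀ U B, P g (τ U) (R *ᵥ B) = P g U B) (hQ : ∀ U B, Q g (τ U) (R *ᵥ B) = Q g U B) (U : X) :
    (gaussian prec hpd χ h0 h1 P Q).integral g (τ U) = (gaussian prec hpd χ h0 h1 P Q).integral g U :=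
  (gaussian prec hpd χ h0 h1 P Q).integral_eq_of_covariant g τ (B12Eq216MeasureCovariance.rotEquiv R hR)
    (gaussian_map_rotEquiv prec hpd χ h0 h1 P Q R hR τ hprec) hχ
    ((gaussian prec hpd χ h0 h1 P Q).exponent_eq_of_covariant g τ (B12Eq216MeasureCovariance.rotEquiv R hR) hP hQ) U

/-- **«therefore the expression (2.13) is gauge invariant» FOR THE GAUSSIAN DATUM**: `𝐄^{(k+1)}(g, τU) = 𝐄^{(k+1)}(g, U)` whenever
the precision of `dμ_{C^{(k)}}` is conjugated by the orthogonal `R` under `τ` (the measure clause, now a theorem) and `χ_k`, `𝐏^{(k)}`,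
`{…}` are jointly invariant under `(U, B) ↦ (τU, RB)` (*«The characteristic function is invariant …»*, *«all the expressions in (2.12)
… are invariant»* — binders). [cite: Balaban1987RG1, (2.16) p.269] -/
theorem newTerm_gaussian_eq_of_covariant (g : ℝ) (R : Matrix κ κ ℝ) (hR : Rᵀ * R = 1) (τ : X → X)
    (hprec : ∀ U, prec (τ U) = R * prec U * Rᵀ) (hχ : ∀ U B, χ (τ U) (R *ᵥ B) = χ U B)
    (hP : ∀ U B, P g (τ U) (R *ᵥ B) = P g U B) (hQ : ∀ U B, Q g (τ U) (R *ᵥ B) = Q g U B) (U : X) :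
    (gaussian prec hpd χ h0 h1 P Q).newTerm g (τ U) = (gaussian prec hpd χ h0 h1 P Q).newTerm g U := by
  rw [newTerm, newTerm, integral_gaussian_eq_of_covariant prec hpd χ h0 h1 P Q g R hR τ hprec hχ hP hQ U]

/-- Along the iterates of `τ` (repeated gauge transformations): `𝐄^{(k+1)}(g, τ^[n]U) = 𝐄^{(k+1)}(g, U)` for the Gaussian datum.
[cite: Balaban1987RG1, (2.16) p.269] -/
theorem newTerm_gaussian_iterate_eq_of_covariant (g : ℝ) (R : Matrix κ κ ℝ) (hR : Rᵀ * R = 1) (τ : X → X)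
    (hprec : ∀ U, prec (τ U) = R * prec U * Rᵀ) (hχ : ∀ U B, χ (τ U) (R *ᵥ B) = χ U B)
    (hP : ∀ U B, P g (τ U) (R *ᵥ B) = P g U B) (hQ : ∀ U B, Q g (τ U) (R *ᵥ B) = Q g U B) (n : ℕ) (U : X) :
    (gaussian prec hpd χ h0 h1 P Q).newTerm g (τ^[n] U) = (gaussian prec hpd χ h0 h1 P Q).newTerm g U :=
  (gaussian prec hpd χ h0 h1 P Q).newTerm_iterate_eq_of_covariant g τ (B12Eq216MeasureCovariance.rotEquiv R hR)
    (gaussian_map_rotEquiv prec hpd χ h0 h1 P Q R hR τ hprec) hχ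
    ((gaussian prec hpd χ h0 h1 P Q).exponent_eq_of_covariant g τ (B12Eq216MeasureCovariance.rotEquiv R hR) hP hQ) n U

/-- **(2.16) FOR PRINT'S GAUSSIAN `dμ_{C^{(k)}(U)}`, `C^{(k)}(U) = (C*Δ^{(k)}(U)C)⁻¹`, WITH `χ_k`, `𝐏^{(k)}`, `{…}` PRINT'S FUNCTIONS OF
`B′` READ AT `B′ = CB`.**  If `Δ^{(k)}` is covariant, `Δ^{(k)}(τU) = R₁Δ^{(k)}(U)R₁ᵀ` (the (3.156) [13] operator under `U ↦ U^u`), the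
elimination map intertwines the two orthogonal actions, `C R₂ = R₁ C`, and `χ_k`, `𝐏^{(k)}`, `{…}` are invariant under
`(U, B′) ↦ (τU, R₁B′)` (*«The characteristic function is invariant with respect to the transformations of the fluctuation field B′,
because they are local, orthogonal transformations»*; *«all the expressions in (2.12) … are invariant»*), then the new term (2.13) of
this datum satisfies `𝐄^{(k+1)}(g, τU) = 𝐄^{(k+1)}(g, U)` — the precision `CᵀΔ^{(k)}C` is conjugated by `R₂`
(`B12Eq216MeasureCovariance.prec_sandwich_covariant`), and the three invariances pull back along `C` (`pullback_invariant_of_intertwine`).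
[cite: Balaban1987RG1, (2.16) p.269 with (2.11)–(2.13) pp.267–268] -/
theorem newTerm_gaussian_prec212_eq_of_covariant {ι : Type*} [Fintype ι] [DecidableEq ι] (Cop : Matrix ι κ ℝ) (Δ : X → Matrix ι ι ℝ)
    (hpd : ∀ U, (prec212 Cop Δ U).PosDef) (χ' : X → (ι → ℝ) → ℝ) (h0' : ∀ U (B : κ → ℝ), 0 ≤ χ' U (Cop *ᵥ B))
    (h1' : ∀ U (B : κ → ℝ), χ' U (Cop *ᵥ B) ≤ 1) (P' Q' : ℝ → X → (ι → ℝ) → ℝ) (g : ℝ) (τ : X → X)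
    (R₁ : Matrix ι ι ℝ) (R₂ : Matrix κ κ ℝ) (hR₁ : R₁ᵀ * R₁ = 1) (hR₂ : R₂ᵀ * R₂ = 1) (hC : Cop * R₂ = R₁ * Cop)
    (hΔ : ∀ U, Δ (τ U) = R₁ * Δ U * R₁ᵀ) (hχ' : ∀ U B', χ' (τ U) (R₁ *ᵥ B') = χ' U B')
    (hP' : ∀ U B', P' g (τ U) (R₁ *ᵥ B') = P' g U B') (hQ' : ∀ U B', Q' g (τ U) (R₁ *ᵥ B') = Q' g U B') (U : X) :
    (gaussian (prec212 Cop Δ) hpd (fun U B => χ' U (Cop *ᵥ B)) h0' h1' (fun g U B => P' g U (Cop *ᵥ B))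
        (fun g U B => Q' g U (Cop *ᵥ B))).newTerm g (τ U)
      = (gaussian (prec212 Cop Δ) hpd (fun U B => χ' U (Cop *ᵥ B)) h0' h1' (fun g U B => P' g U (Cop *ᵥ B))
        (fun g U B => Q' g U (Cop *ᵥ B))).newTerm g U :=
  newTerm_gaussian_eq_of_covariant (prec212 Cop Δ) hpd (fun U B => χ' U (Cop *ᵥ B)) h0' h1'
    (fun g U B => P' g U (Cop *ᵥ B)) (fun g U B => Q' g U (Cop *ᵥ B)) g R₂ hR₂ τ
    (fun U => B12Eq216MeasureCovariance.prec_sandwich_covariant Cop R₁ R₂ hR₁ hR₂ hC hΔ U)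
    (fun U B => pullback_invariant_of_intertwine Cop R₁ R₂ hC χ' hχ' U B)
    (fun U B => pullback_invariant_of_intertwine Cop R₁ R₂ hC (P' g) hP' U B)
    (fun U B => pullback_invariant_of_intertwine Cop R₁ R₂ hC (Q' g) hQ' U B) U

end FluctData

/-- **ALL OF (2.12) IS INVARIANT, FOR THE GAUSSIAN DATUM** (§3's `action212_eq_of_covariant` with `hμ` discharged): given the invariance of
the first line `A_k^{(1.3)}` and of the `Z^{(k)}`-bracket under `τ` (hypotheses `h13`, `hZ` — (1.19) at the levels `≤ k` and the gauge
invariance of (1.4)), a covariant precision and jointly invariant `χ_k`, `𝐏^{(k)}`, `{…}`, the body of (2.12) satisfies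
`A_{k+1}(τU) = A_{k+1}(U)`. [cite: Balaban1987RG1, (2.16) p.269 with (2.12) p.268] -/
theorem action212_gaussian_eq_of_covariant {P : Params} {G : Type*} [GaugeGroup G] {Φ 𝒢 : Type*} (T : SFTower P G Φ 𝒢) (k : ℕ)
    (prec : GaugeField P 0 G → Matrix κ κ ℝ) (hpd : ∀ U, (prec U).PosDef) (χ : GaugeField P 0 G → (κ → ℝ) → ℝ)
    (h0 : ∀ U B, 0 ≤ χ U B) (h1 : ∀ U B, χ U B ≤ 1) (Pk Qk : ℝ → GaugeField P 0 G → (κ → ℝ) → ℝ)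
    (R : Matrix κ κ ℝ) (hR : Rᵀ * R = 1) (τ : GaugeField P 0 G → GaugeField P 0 G)
    (hprec : ∀ U, prec (τ U) = R * prec U * Rᵀ) (hχ : ∀ U B, χ (τ U) (R *ᵥ B) = χ U B)
    (hP : ∀ U B, Pk (T.flow.g k) (τ U) (R *ᵥ B) = Pk (T.flow.g k) U B)
    (hQ : ∀ U B, Qk (T.flow.g k) (τ U) (R *ᵥ B) = Qk (T.flow.g k) U B)
    (h13 : ∀ U, T.action13 k (τ U) = T.action13 k U) (hZ : ∀ U, T.logZ k (τ U) = T.logZ k U) (U : GaugeField P 0 G) :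
    action212 T k (FluctData.gaussian prec hpd χ h0 h1 Pk Qk) (τ U) = action212 T k (FluctData.gaussian prec hpd χ h0 h1 Pk Qk) U :=
  action212_eq_of_covariant T k (FluctData.gaussian prec hpd χ h0 h1 Pk Qk) τ (B12Eq216MeasureCovariance.rotEquiv R hR)
    (FluctData.gaussian_map_rotEquiv prec hpd χ h0 h1 Pk Qk R hR τ hprec) hχ
    ((FluctData.gaussian prec hpd χ h0 h1 Pk Qk).exponent_eq_of_covariant (T.flow.g k) τ (B12Eq216MeasureCovariance.rotEquiv R hR) hP hQ) h13 hZ U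

end GaussianCovariant

/-! ## §6. p. 268 *«C is the operator determined by the configuration V^{(k)}»*: the elimination map DEPENDS ON THE BACKGROUND —
print's precision `C(U)*Δ^{(k)}(U)C(U)` with a `U_{k+1}`-dependent `C`, and (2.16) for it (v1.4) -/

section BackgroundDependentC

open scoped Matrix
open ProbabilityTheory

/-- **PRINT'S PRECISION WITH THE BACKGROUND-DEPENDENT ELIMINATION MAP.**  p. 268: *«Denoting the remaining variables by B we have
B′ = CB, C is the operator determined by the configuration V^{(k)}»* — and `V^{(k)} = V^{(k)}(U_{k+1})` ((2.2)–(2.3)), so `C = C(U_{k+1})`.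
`prec212U Cop Δ U := (C(U))ᵀ · Δ^{(k)}(U) · C(U)`; §4's `prec212` (v1.2) is the background-CONSTANT special case (`prec212U_const`) —
a located over-specialisation of this file's own v1.2, repaired here without touching v1.2's declarations. [cite: Balaban1987RG1, (2.11)–(2.12) pp.267–268] -/
def prec212U {X : Type*} {ι κ : Type*} [Fintype ι] (Cop : X → Matrix ι κ ℝ) (Δ : X → Matrix ι ι ℝ) (U : X) : Matrix κ κ ℝ :=
  (Cop U).transpose * Δ U * Cop U

/-- `prec212U Cop Δ U = (C(U))ᵀ · Δ(U) · C(U)`. [cite: Balaban1987RG1, (2.11)–(2.12) pp.267–268] -/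
theorem prec212U_def {X : Type*} {ι κ : Type*} [Fintype ι] (Cop : X → Matrix ι κ ℝ) (Δ : X → Matrix ι ι ℝ) (U : X) :
    prec212U Cop Δ U = (Cop U).transpose * Δ U * Cop U := rfl

/-- At each background the `U`-dependent precision IS §4's `prec212` at the matrix `C(U)`. [cite: Balaban1987RG1, (2.11)–(2.12) pp.267–268] -/
theorem prec212U_apply {X : Type*} {ι κ : Type*} [Fintype ι] (Cop : X → Matrix ι κ ℝ) (Δ : X → Matrix ι ι ℝ) (U : X) :
    prec212U Cop Δ U = prec212 (Cop U) Δ U := rfl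

/-- §4's `prec212 Cop Δ` (v1.2) is the background-constant case `C(U) ≡ Cop`. [cite: Balaban1987RG1, (2.11)–(2.12) pp.267–268] -/
theorem prec212U_const {X : Type*} {ι κ : Type*} [Fintype ι] (Cop : Matrix ι κ ℝ) (Δ : X → Matrix ι ι ℝ) :
    prec212U (fun _ : X => Cop) Δ = prec212 Cop Δ := rfl

/-- **«B′ = CB»** in the quadratic form, `C = C(U)`: `⟨B, (C(U)ᵀΔ(U)C(U))B⟩ = ⟨C(U)B, Δ(U)(C(U)B)⟩`.
[cite: Balaban1987RG1, (2.11)–(2.12) pp.267–268] -/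
theorem quadForm_prec212U {X : Type*} {ι κ : Type*} [Fintype ι] [Fintype κ] (Cop : X → Matrix ι κ ℝ)
    (Δ : X → Matrix ι ι ℝ) (U : X) (B : κ → ℝ) :
    B ⬝ᵥ (prec212U Cop Δ U *ᵥ B) = (Cop U *ᵥ B) ⬝ᵥ (Δ U *ᵥ (Cop U *ᵥ B)) :=
  quadForm_prec212 (Cop U) Δ U B

/-- Positive definiteness at each background: `Δ^{(k)}(U)` positive definite and `C(U)` injective. [cite: Balaban1987RG1, (2.11)–(2.12) pp.267–268] -/
theorem posDef_prec212U {X : Type*} {ι κ : Type*} [Fintype ι] [Fintype κ] [DecidableEq ι] [DecidableEq κ]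
    (Cop : X → Matrix ι κ ℝ) (Δ : X → Matrix ι ι ℝ) (U : X) (hΔ : (Δ U).PosDef) (hC : Function.Injective (Cop U).mulVec) :
    (prec212U Cop Δ U).PosDef :=
  posDef_prec212 (Cop U) Δ U hΔ hC

variable {X : Type*} {ι : Type*} [Fintype ι] [DecidableEq ι] {κ : Type} [Fintype κ] [DecidableEq κ]

/-- The background-dependent INTERTWINING `C(τU) R₂ = R₁ C(U)` (the fluctuation field `B′` transforms by `R₁`, the remaining
variables by `R₂`, and the elimination map of the transformed background carries one to the other) gives, for orthogonal `R₁`,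
`R₂`, `R₁ᵀ C(τU) = C(U) R₂ᵀ`. [cite: Balaban1987RG1, (2.16) p.269 with (2.11)–(2.12) pp.267–268] -/
theorem transpose_mul_of_intertwineU (Cop : X → Matrix ι κ ℝ) (R₁ : Matrix ι ι ℝ) (R₂ : Matrix κ κ ℝ)
    (hR₁ : R₁ᵀ * R₁ = 1) (hR₂ : R₂ᵀ * R₂ = 1) {τ : X → X} (hC : ∀ U, Cop (τ U) * R₂ = R₁ * Cop U) (U : X) :
    R₁ᵀ * Cop (τ U) = Cop U * R₂ᵀ := by
  calc R₁ᵀ * Cop (τ U) = R₁ᵀ * Cop (τ U) * (R₂ * R₂ᵀ) := by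
        rw [B13GaugeDevices.mul_transpose_self_of_transpose_mul_self R₂ hR₂, Matrix.mul_one]
    _ = R₁ᵀ * (Cop (τ U) * R₂) * R₂ᵀ := by simp only [Matrix.mul_assoc]
    _ = R₁ᵀ * R₁ * Cop U * R₂ᵀ := by rw [hC]; simp only [Matrix.mul_assoc]
    _ = Cop U * R₂ᵀ := by rw [hR₁, Matrix.one_mul]

/-- **PRINT'S PRECISION IS COVARIANT, with the background-dependent `C`**: `Δ^{(k)}(τU) = R₁Δ^{(k)}(U)R₁ᵀ` and
`C(τU) R₂ = R₁ C(U)` give `C(τU)ᵀ Δ^{(k)}(τU) C(τU) = R₂ (C(U)ᵀ Δ^{(k)}(U) C(U)) R₂ᵀ` — the hypothesis `hprec` of §5 for `prec212U`.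
(The background-constant case is r09's `B12Eq216MeasureCovariance.prec_sandwich_covariant`.) [cite: Balaban1987RG1, (2.16) p.269 with (2.11)–(2.12) pp.267–268] -/
theorem prec212U_covariant (Cop : X → Matrix ι κ ℝ) (R₁ : Matrix ι ι ℝ) (R₂ : Matrix κ κ ℝ) (hR₁ : R₁ᵀ * R₁ = 1)
    (hR₂ : R₂ᵀ * R₂ = 1) {τ : X → X} (hC : ∀ U, Cop (τ U) * R₂ = R₁ * Cop U) {Δ : X → Matrix ι ι ℝ}
    (hΔ : ∀ U, Δ (τ U) = R₁ * Δ U * R₁ᵀ) (U : X) :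
    prec212U Cop Δ (τ U) = R₂ * prec212U Cop Δ U * R₂ᵀ := by
  have h1 : R₁ᵀ * Cop (τ U) = Cop U * R₂ᵀ := transpose_mul_of_intertwineU Cop R₁ R₂ hR₁ hR₂ hC U
  have h2 : (Cop (τ U))ᵀ * R₁ = R₂ * (Cop U)ᵀ := by
    have h := congrArg Matrix.transpose h1
    simpa only [Matrix.transpose_mul, Matrix.transpose_transpose] using h
  rw [prec212U_def, prec212U_def, hΔ]
  calc (Cop (τ U))ᵀ * (R₁ * Δ U * R₁ᵀ) * Cop (τ U) = (Cop (τ U))ᵀ * R₁ * Δ U * (R₁ᵀ * Cop (τ U)) := by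
        simp only [Matrix.mul_assoc]
    _ = R₂ * (Cop U)ᵀ * Δ U * (Cop U * R₂ᵀ) := by rw [h2, h1]
    _ = R₂ * ((Cop U)ᵀ * Δ U * Cop U) * R₂ᵀ := by simp only [Matrix.mul_assoc]

omit [DecidableEq ι] [DecidableEq κ] in
/-- A function of `B′` invariant under `(U, B′) ↦ (τU, R₁B′)`, read at `B′ = C(U)B`, is invariant under `(U, B) ↦ (τU, R₂B)` when
`C(τU) R₂ = R₁ C(U)`. [cite: Balaban1987RG1, (2.16) p.269 with (2.11)–(2.12) pp.267–268] -/
theorem pullback_invariant_of_intertwineU {β : Type*} (Cop : X → Matrix ι κ ℝ) (R₁ : Matrix ι ι ℝ) (R₂ : Matrix κ κ ℝ)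
    {τ : X → X} (hC : ∀ U, Cop (τ U) * R₂ = R₁ * Cop U) (F : X → (ι → ℝ) → β)
    (hF : ∀ U B', F (τ U) (R₁ *ᵥ B') = F U B') (U : X) (B : κ → ℝ) :
    F (τ U) (Cop (τ U) *ᵥ (R₂ *ᵥ B)) = F U (Cop U *ᵥ B) := by
  rw [Matrix.mulVec_mulVec, hC, ← Matrix.mulVec_mulVec, hF]

namespace FluctData

variable (χ : X → (κ → ℝ) → ℝ) (h0 : ∀ U B, 0 ≤ χ U B) (h1 : ∀ U B, χ U B ≤ 1) (P Q : ℝ → X → (κ → ℝ) → ℝ)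

/-- **THE MEASURE CLAUSE FOR PRINT'S GAUSSIAN WITH `C = C(U)`**: `(dμ_{C^{(k)}(U)}).map (B ↦ R₂B) = dμ_{C^{(k)}(τU)}` for
`C^{(k)}(U) = (C(U)*Δ^{(k)}(U)C(U))⁻¹`, from the covariance of `Δ^{(k)}` and the background-dependent intertwining.
[cite: Balaban1987RG1, (2.16) p.269 with (2.11)–(2.12) pp.267–268] -/
theorem gaussian_prec212U_map_rotEquiv (Cop : X → Matrix ι κ ℝ) (Δ : X → Matrix ι ι ℝ) (hpd : ∀ U, (prec212U Cop Δ U).PosDef)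
    (τ : X → X) (R₁ : Matrix ι ι ℝ) (R₂ : Matrix κ κ ℝ) (hR₁ : R₁ᵀ * R₁ = 1) (hR₂ : R₂ᵀ * R₂ = 1)
    (hC : ∀ U, Cop (τ U) * R₂ = R₁ * Cop U) (hΔ : ∀ U, Δ (τ U) = R₁ * Δ U * R₁ᵀ) (U : X) :
    ((gaussian (prec212U Cop Δ) hpd χ h0 h1 P Q).μ U).map ⇑(B12Eq216MeasureCovariance.rotEquiv R₂ hR₂)
      = (gaussian (prec212U Cop Δ) hpd χ h0 h1 P Q).μ (τ U) :=
  gaussian_map_rotEquiv (prec212U Cop Δ) hpd χ h0 h1 P Q R₂ hR₂ τ (fun U => prec212U_covariant Cop R₁ R₂ hR₁ hR₂ hC hΔ U) U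

/-- **(2.16) FOR PRINT'S GAUSSIAN WITH THE BACKGROUND-DEPENDENT ELIMINATION MAP, `χ_k`, `𝐏^{(k)}`, `{…}` PRINT'S FUNCTIONS OF `B′`
READ AT `B′ = C(U)B`**: covariance of `Δ^{(k)}`, the intertwining `C(τU) R₂ = R₁ C(U)` and the invariance of `χ_k`, `𝐏^{(k)}`,
`{…}` under `(U, B′) ↦ (τU, R₁B′)` give `𝐄^{(k+1)}(g, τU) = 𝐄^{(k+1)}(g, U)`. [cite: Balaban1987RG1, (2.16) p.269 with (2.11)–(2.13) pp.267–268] -/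
theorem newTerm_gaussian_prec212U_eq_of_covariant (Cop : X → Matrix ι κ ℝ) (Δ : X → Matrix ι ι ℝ)
    (hpd : ∀ U, (prec212U Cop Δ U).PosDef) (χ' : X → (ι → ℝ) → ℝ) (h0' : ∀ U (B : κ → ℝ), 0 ≤ χ' U (Cop U *ᵥ B))
    (h1' : ∀ U (B : κ → ℝ), χ' U (Cop U *ᵥ B) ≤ 1) (P' Q' : ℝ → X → (ι → ℝ) → ℝ) (g : ℝ) (τ : X → X)
    (R₁ : Matrix ι ι ℝ) (R₂ : Matrix κ κ ℝ) (hR₁ : R₁ᵀ * R₁ = 1) (hR₂ : R₂ᵀ * R₂ = 1)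
    (hC : ∀ U, Cop (τ U) * R₂ = R₁ * Cop U) (hΔ : ∀ U, Δ (τ U) = R₁ * Δ U * R₁ᵀ)
    (hχ' : ∀ U B', χ' (τ U) (R₁ *ᵥ B') = χ' U B') (hP' : ∀ U B', P' g (τ U) (R₁ *ᵥ B') = P' g U B')
    (hQ' : ∀ U B', Q' g (τ U) (R₁ *ᵥ B') = Q' g U B') (U : X) :
    (gaussian (prec212U Cop Δ) hpd (fun U B => χ' U (Cop U *ᵥ B)) h0' h1' (fun g U B => P' g U (Cop U *ᵥ B))
        (fun g U B => Q' g U (Cop U *ᵥ B))).newTerm g (τ U)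
      = (gaussian (prec212U Cop Δ) hpd (fun U B => χ' U (Cop U *ᵥ B)) h0' h1' (fun g U B => P' g U (Cop U *ᵥ B))
        (fun g U B => Q' g U (Cop U *ᵥ B))).newTerm g U :=
  newTerm_gaussian_eq_of_covariant (prec212U Cop Δ) hpd (fun U B => χ' U (Cop U *ᵥ B)) h0' h1'
    (fun g U B => P' g U (Cop U *ᵥ B)) (fun g U B => Q' g U (Cop U *ᵥ B)) g R₂ hR₂ τ
    (fun U => prec212U_covariant Cop R₁ R₂ hR₁ hR₂ hC hΔ U)
    (fun U B => pullback_invariant_of_intertwineU Cop R₁ R₂ hC χ' hχ' U B)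
    (fun U B => pullback_invariant_of_intertwineU Cop R₁ R₂ hC (P' g) hP' U B)
    (fun U B => pullback_invariant_of_intertwineU Cop R₁ R₂ hC (Q' g) hQ' U B) U

omit [DecidableEq ι] in
/-- **«with the covariance C^{(k)} = C^{(k)}(U_{k+1}) = (C*Δ^{(k)}C)⁻¹», `C = C(U_{k+1})`**: under the Gaussian datum at `prec212U` the
covariance matrix of the remaining variables is `(C(U)ᵀΔ^{(k)}(U)C(U))⁻¹` — the `U_{k+1}`-dependence print displays on BOTH factors.
[cite: Balaban1987RG1, (2.11)–(2.12) pp.267–268] -/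
theorem covariance_gaussian_prec212U (Cop : X → Matrix ι κ ℝ) (Δ : X → Matrix ι ι ℝ)
    (hpd : ∀ U, (prec212U Cop Δ U).PosDef) (U : X) (a b : κ) :
    cov[fun B : κ → ℝ => B a, fun B => B b; (gaussian (prec212U Cop Δ) hpd χ h0 h1 P Q).μ U]
      = ((Cop U).transpose * Δ U * Cop U)⁻¹ a b :=
  covariance_gaussian (prec212U Cop Δ) hpd χ h0 h1 P Q U a b

end FluctData

end BackgroundDependentC

/-! ### §6b. The intertwining `C(τU) R₂ = R₁ C(U)` DISCHARGED for the tree's elimination map `Beta.ConstraintElimination.elim` -/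

section Elim

open Matrix Beta.ConstraintElimination

variable {σ κc : Type*} [Fintype σ] [Fintype κc] [DecidableEq σ] [DecidableEq κc]

/-- A block-diagonal orthogonal transformation of all the variables (print's `R(u)` acts bondwise, (2.16): it preserves the
splitting retained ∕ eliminated bonds) is orthogonal: `RσᵀRσ = 1`, `RκᵀRκ = 1` ⇒ `R₁ᵀR₁ = 1` for `R₁ = diag(Rσ, Rκ)`.
[cite: Balaban1987RG1, (2.16) p.269] -/
theorem fromBlocks_diag_orthogonal (Rσ : Matrix σ σ ℝ) (Rκ : Matrix κc κc ℝ) (hσ : Rσᵀ * Rσ = 1) (hκ : Rκᵀ * Rκ = 1) :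
    (fromBlocks Rσ 0 0 Rκ)ᵀ * fromBlocks Rσ 0 0 Rκ = 1 := by
  rw [fromBlocks_transpose, fromBlocks_multiply]
  simp [hσ, hκ]

/-- **THE ELIMINATION MAP INTERTWINES THE GAUGE ROTATIONS** — the hypothesis `C(τU) R₂ = R₁ C(U)` of §6 DISCHARGED for the
tree's `C = Beta.ConstraintElimination.elim Q_σ Q_κ = [1 ; −Q_κ⁻¹Q_σ]` ([13] (3.157); *«B′ = CB»*): if the rotation of all the
variables is block-diagonal for the splitting retained ∕ eliminated, `R₁ = diag(Rσ, Rκ)`, and the linear constraint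
`Q = [Q_σ | Q_κ]` (print's `Q̃`, eliminated by `δ(Q̃B′)`) is COVARIANT — `Q′ R₁ = S Q` for the transformed background's constraint
`Q′` and some matrix `S` on the constraint values (for [I]'s average: conjugation by `u(Lc₋)`, `B12Average012QtildeCovariance`) —
then `C′ Rσ = R₁ C`: rotating the remaining variables and eliminating at the new background = eliminating and rotating all
variables.  Proof: both columns agree on the retained coordinates and solve the new constraint; `elim_unique`.
[cite: Balaban1987RG1, (2.16) p.269 with (2.11) p.267; Balaban1985BackgroundPropagators, (3.157) p.428] -/
theorem elim_intertwine {Qσ Qσ' : Matrix κc σ ℝ} {Qκ Qκ' : Matrix κc κc ℝ} (hκ : IsUnit Qκ.det) (hκ' : IsUnit Qκ'.det)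
    {Rσ : Matrix σ σ ℝ} {Rκ : Matrix κc κc ℝ} {S : Matrix κc κc ℝ}
    (hcov : fromCols Qσ' Qκ' * fromBlocks Rσ 0 0 Rκ = S * fromCols Qσ Qκ) :
    elim Qσ' Qκ' * Rσ = fromBlocks Rσ 0 0 Rκ * elim Qσ Qκ := by
  rw [Matrix.ext_iff_mulVec]
  intro v
  rw [← mulVec_mulVec, ← mulVec_mulVec]
  symm
  apply elim_unique Qσ' Qκ' hκ' (Rσ *ᵥ v)
  · intro s
    simp [fromBlocks_mulVec, elim, fromRows_mulVec]
  · rw [mulVec_mulVec, mulVec_mulVec, hcov, Matrix.mul_assoc, constraint_mul_elim Qσ Qκ hκ, Matrix.mul_zero,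
      zero_mulVec]

variable {X : Type*}

/-- The same along a family of backgrounds: constraints `Q(U) = [Q_σ(U) | Q_κ(U)]` covariant under `τ` (`Q(τU) R₁ = S(U) Q(U)`)
⇒ `C(τU) Rσ = R₁ C(U)` for `C(U) = elim (Q_σ U) (Q_κ U)` — exactly the binder `hC` of `prec212U_covariant` ∕
`newTerm_gaussian_prec212U_eq_of_covariant` at `R₂ := Rσ`. [cite: Balaban1987RG1, (2.16) p.269 with (2.11) p.267] -/
theorem elim_intertwine_family (Qσ : X → Matrix κc σ ℝ) (Qκ : X → Matrix κc κc ℝ) (hκ : ∀ U, IsUnit (Qκ U).det)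
    {τ : X → X} {Rσ : Matrix σ σ ℝ} {Rκ : Matrix κc κc ℝ} (S : X → Matrix κc κc ℝ)
    (hcov : ∀ U, fromCols (Qσ (τ U)) (Qκ (τ U)) * fromBlocks Rσ 0 0 Rκ = S U * fromCols (Qσ U) (Qκ U)) (U : X) :
    elim (Qσ (τ U)) (Qκ (τ U)) * Rσ = fromBlocks Rσ 0 0 Rκ * elim (Qσ U) (Qκ U) :=
  elim_intertwine (hκ U) (hκ (τ U)) (hcov U)

variable {σ : Type} [Fintype σ] [DecidableEq σ]

/-- **(2.16) FOR PRINT'S GAUSSIAN AT THE TREE'S ELIMINATION MAP** — of the three binders of §6 the intertwining is now a theorem: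
for `C(U) = elim (Q_σ U) (Q_κ U)` (invertible `Q_κ(U)`), a bondwise (block-diagonal) orthogonal `R₁ = diag(Rσ, Rκ)`, a covariant
constraint `Q(τU) R₁ = S(U) Q(U)`, a covariant `Δ^{(k)}` (`Δ(τU) = R₁ Δ(U) R₁ᵀ`) and `χ_k`, `𝐏^{(k)}`, `{…}` print's functions of `B′`
invariant under `(U, B′) ↦ (τU, R₁B′)`, the new term (2.13) of the Gaussian datum at precision `C(U)ᵀΔ^{(k)}(U)C(U)` satisfies
`𝐄^{(k+1)}(g, τU) = 𝐄^{(k+1)}(g, U)`. [cite: Balaban1987RG1, (2.16) p.269 with (2.11)–(2.13) pp.267–268] -/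
theorem FluctData.newTerm_gaussian_elim_eq_of_covariant (Qσ : X → Matrix κc σ ℝ) (Qκ : X → Matrix κc κc ℝ)
    (hκ : ∀ U, IsUnit (Qκ U).det) (Δ : X → Matrix (σ ⊕ κc) (σ ⊕ κc) ℝ)
    (hpd : ∀ U, (prec212U (fun U => elim (Qσ U) (Qκ U)) Δ U).PosDef) (χ' : X → (σ ⊕ κc → ℝ) → ℝ)
    (h0' : ∀ U (B : σ → ℝ), 0 ≤ χ' U (elim (Qσ U) (Qκ U) *ᵥ B)) (h1' : ∀ U (B : σ → ℝ), χ' U (elim (Qσ U) (Qκ U) *ᵥ B) ≤ 1)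
    (P' Q' : ℝ → X → (σ ⊕ κc → ℝ) → ℝ) (g : ℝ) (τ : X → X) (Rσ : Matrix σ σ ℝ) (Rκ : Matrix κc κc ℝ)
    (hRσ : Rσᵀ * Rσ = 1) (hRκ : Rκᵀ * Rκ = 1) (S : X → Matrix κc κc ℝ)
    (hcov : ∀ U, fromCols (Qσ (τ U)) (Qκ (τ U)) * fromBlocks Rσ 0 0 Rκ = S U * fromCols (Qσ U) (Qκ U))
    (hΔ : ∀ U, Δ (τ U) = fromBlocks Rσ 0 0 Rκ * Δ U * (fromBlocks Rσ 0 0 Rκ)ᵀ)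
    (hχ' : ∀ U B', χ' (τ U) (fromBlocks Rσ 0 0 Rκ *ᵥ B') = χ' U B')
    (hP' : ∀ U B', P' g (τ U) (fromBlocks Rσ 0 0 Rκ *ᵥ B') = P' g U B')
    (hQ' : ∀ U B', Q' g (τ U) (fromBlocks Rσ 0 0 Rκ *ᵥ B') = Q' g U B') (U : X) :
    (FluctData.gaussian (prec212U (fun U => elim (Qσ U) (Qκ U)) Δ) hpd (fun U B => χ' U (elim (Qσ U) (Qκ U) *ᵥ B)) h0' h1'
        (fun g U B => P' g U (elim (Qσ U) (Qκ U) *ᵥ B)) (fun g U B => Q' g U (elim (Qσ U) (Qκ U) *ᵥ B))).newTerm g (τ U)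
      = (FluctData.gaussian (prec212U (fun U => elim (Qσ U) (Qκ U)) Δ) hpd (fun U B => χ' U (elim (Qσ U) (Qκ U) *ᵥ B)) h0' h1'
        (fun g U B => P' g U (elim (Qσ U) (Qκ U) *ᵥ B)) (fun g U B => Q' g U (elim (Qσ U) (Qκ U) *ᵥ B))).newTerm g U :=
  FluctData.newTerm_gaussian_prec212U_eq_of_covariant (fun U => elim (Qσ U) (Qκ U)) Δ hpd χ' h0' h1' P' Q' g τ
    (fromBlocks Rσ 0 0 Rκ) Rσ (fromBlocks_diag_orthogonal Rσ Rκ hRσ hRκ) hRσ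
    (fun U => elim_intertwine_family Qσ Qκ hκ S hcov U) hΔ hχ' hP' hQ' U

end Elim

/-! ## §7. p. 269 *«all the expressions in (2.12), together with the measure, are invariant»* READ LITERALLY for the quadratic form
`½⟨B′, Δ^{(k)}B′⟩` of (2.11): INVARIANCE OF THE FORM ⇔ the conjugation hypothesis `Δ^{(k)}(τU) = R₁Δ^{(k)}(U)R₁ᵀ` of §§5–6 (v1.5) -/

section FormInvariance

open scoped Matrix

variable {ι : Type} [Fintype ι] [DecidableEq ι]

/-- A symmetric real matrix is determined by its quadratic form (polarization).  Matrix ∕ `dotProduct` twin of the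
polarization step inside r07's `B10SectCExpansion.quadForm54_unique` (symmetric linear maps on an inner-product space,
[Balaban1985UV3] (54)); no bridge owed — different carriers, same folklore. [folklore] -/
private theorem eq_of_isSymm_of_quadForm_eq {A B : Matrix ι ι ℝ} (hA : A.IsSymm) (hB : B.IsSymm)
    (h : ∀ v : ι → ℝ, v ⬝ᵥ (A *ᵥ v) = v ⬝ᵥ (B *ᵥ v)) : A = B := by
  have symm : ∀ (M : Matrix ι ι ℝ), M.IsSymm → ∀ v w : ι → ℝ, w ⬝ᵥ (M *ᵥ v) = v ⬝ᵥ (M *ᵥ w) := by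
    intro M hM v w
    calc w ⬝ᵥ (M *ᵥ v) = w ⬝ᵥ (v ᵥ* Mᵀ) := by rw [Matrix.vecMul_transpose]
      _ = w ⬝ᵥ (v ᵥ* M) := by rw [hM.eq]
      _ = (v ᵥ* M) ⬝ᵥ w := dotProduct_comm _ _
      _ = v ⬝ᵥ (M *ᵥ w) := (Matrix.dotProduct_mulVec v M w).symm
  have key : ∀ v w : ι → ℝ, w ⬝ᵥ (A *ᵥ v) = w ⬝ᵥ (B *ᵥ v) := by
    intro v w
    have h1 := h (v + w)
    simp only [Matrix.mulVec_add, add_dotProduct, dotProduct_add, h v, h w, symm A hA w v, symm B hB w v] at h1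
    linarith
  ext i j
  have := key (Pi.single j 1) (Pi.single i 1)
  simpa [Matrix.mulVec_single_one, single_one_dotProduct] using this

/-- **INVARIANCE OF THE QUADRATIC FORM `½⟨B′, Δ^{(k)}B′⟩` UNDER `(U, B′) ↦ (τU, R₁B′)` ⇒ THE CONJUGATION LAW.**  For symmetric
`Δ^{(k)}(U)`, `Δ^{(k)}(τU)` and an orthogonal `R₁`: `⟨R₁B′, Δ^{(k)}(τU) R₁B′⟩ = ⟨B′, Δ^{(k)}(U) B′⟩` for all `B′` implies
`Δ^{(k)}(τU) = R₁ Δ^{(k)}(U) R₁ᵀ` — print's invariance sentence for the (2.11) form, read literally, IS the binder `hΔ` of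
`prec212U_covariant` ∕ `elim_intertwine`'s companions. [cite: Balaban1987RG1, (2.16) p.269 with (2.11) p.267] -/
theorem conj_eq_of_quadForm_invariant {Δ Δ' : Matrix ι ι ℝ} (hΔ : Δ.IsSymm) (hΔ' : Δ'.IsSymm) (R₁ : Matrix ι ι ℝ)
    (hR₁ : R₁ᵀ * R₁ = 1) (hinv : ∀ B' : ι → ℝ, (R₁ *ᵥ B') ⬝ᵥ (Δ' *ᵥ (R₁ *ᵥ B')) = B' ⬝ᵥ (Δ *ᵥ B')) :
    Δ' = R₁ * Δ * R₁ᵀ := by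
  -- the pulled-back matrix `R₁ᵀ Δ' R₁` has the same quadratic form as `Δ`
  have hform : ∀ B' : ι → ℝ, B' ⬝ᵥ ((R₁ᵀ * Δ' * R₁) *ᵥ B') = B' ⬝ᵥ (Δ *ᵥ B') := by
    intro B'
    rw [← hinv B', ← Matrix.mulVec_mulVec, ← Matrix.mulVec_mulVec, Matrix.dotProduct_mulVec, Matrix.vecMul_transpose]
  have hsym : (R₁ᵀ * Δ' * R₁).IsSymm := by
    unfold Matrix.IsSymm
    rw [Matrix.transpose_mul, Matrix.transpose_mul, Matrix.transpose_transpose, hΔ'.eq, Matrix.mul_assoc]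
  have hpull : R₁ᵀ * Δ' * R₁ = Δ := eq_of_isSymm_of_quadForm_eq hsym hΔ hform
  have hRRt : R₁ * R₁ᵀ = 1 := B13GaugeDevices.mul_transpose_self_of_transpose_mul_self R₁ hR₁
  calc Δ' = (R₁ * R₁ᵀ) * Δ' * (R₁ * R₁ᵀ) := by rw [hRRt, Matrix.one_mul, Matrix.mul_one]
    _ = R₁ * (R₁ᵀ * Δ' * R₁) * R₁ᵀ := by simp only [Matrix.mul_assoc]
    _ = R₁ * Δ * R₁ᵀ := by rw [hpull]

/-- The converse (the conjugation law gives the invariance of the form), for completeness: `Δ' = R₁ Δ R₁ᵀ`, `R₁ᵀR₁ = 1` ⇒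
`⟨R₁B′, Δ' R₁B′⟩ = ⟨B′, Δ B′⟩`. [cite: Balaban1987RG1, (2.16) p.269 with (2.11) p.267] -/
theorem quadForm_invariant_of_conj_eq {Δ Δ' : Matrix ι ι ℝ} (R₁ : Matrix ι ι ℝ) (hR₁ : R₁ᵀ * R₁ = 1)
    (hconj : Δ' = R₁ * Δ * R₁ᵀ) (B' : ι → ℝ) :
    (R₁ *ᵥ B') ⬝ᵥ (Δ' *ᵥ (R₁ *ᵥ B')) = B' ⬝ᵥ (Δ *ᵥ B') := by
  rw [hconj]
  exact B13GaugeDevices.quadForm_conj R₁ Δ hR₁ B'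

/-- Along a family of backgrounds: the literal invariance of the (2.11) form under `(U, B′) ↦ (τU, R₁B′)` for symmetric
`Δ^{(k)}(·)` yields the binder `hΔ : ∀ U, Δ(τU) = R₁ Δ(U) R₁ᵀ` of §§5–6. [cite: Balaban1987RG1, (2.16) p.269 with (2.11) p.267] -/
theorem conj_family_of_quadForm_invariant {X : Type*} {τ : X → X} (Δ : X → Matrix ι ι ℝ) (hsymm : ∀ U, (Δ U).IsSymm)
    (R₁ : Matrix ι ι ℝ) (hR₁ : R₁ᵀ * R₁ = 1)
    (hinv : ∀ U (B' : ι → ℝ), (R₁ *ᵥ B') ⬝ᵥ (Δ (τ U) *ᵥ (R₁ *ᵥ B')) = B' ⬝ᵥ (Δ U *ᵥ B')) (U : X) :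
    Δ (τ U) = R₁ * Δ U * R₁ᵀ :=
  conj_eq_of_quadForm_invariant (hsymm U) (hsymm (τ U)) R₁ hR₁ (hinv U)

end FormInvariance

/-! ## §8. p. 269 *«The characteristic function is invariant … because they are local, orthogonal transformations»*: the `χ_k`
binder DISCHARGED for print's `χ_k` (r09's `B12SmallFieldDomain259.chiFluct` ∕ `chiFluctPrinted`) on print's carrier — the
fluctuation fields `B′ : T^{(k)}-bonds → 𝔤` — with the bondwise isometries as r07's measurable equivalence `B10Eq26MeasureInv.rot` (v1.5) -/

section OnBonds

variable {P : Params} {k : ℕ} {𝔤 : Type} [NormedAddCommGroup 𝔤] [MeasurableSpace 𝔤]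
variable {X : Type*}

namespace FluctData

/-- **THE DATUM ON PRINT'S CARRIER WITH PRINT'S `χ_k`.**  Fluctuation variables `B′ ∈ VecField P k 𝔤` (a `𝔤`-valued function on
the bonds of `T^{(k)}`), measures `dμ_{C^{(k)}(U)}` a parameter family of probability measures on it, `χ_k := B12SmallFieldDomain259.chiFluct ε₁` (the
all-bonds cutoff `Π_b χ(|B′(b)| < ε₁)` of `B12SmallFieldDomain259`; for the printed product over `b ∉ {b₀(c)}` see `onBondsPrinted`),
exponent parts `𝐏^{(k)}`, `{…}` parameters. [cite: Balaban1987RG1, (2.9) p.266, (2.12)–(2.13) p.268] -/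
def onBonds (μ : X → Measure (VecField P k 𝔤)) (hμ : ∀ U, IsProbabilityMeasure (μ U)) (ε₁ : ℝ)
    (Pk Qk : ℝ → X → VecField P k 𝔤 → ℝ) : FluctData X where
  𝓑 := VecField P k 𝔤
  m𝓑 := inferInstance
  μ := μ
  prob := hμ
  χ := fun _ B => B12SmallFieldDomain259.chiFluct ε₁ B
  χ_nonneg := fun _ B => (B12SmallFieldDomain259.chiFluct_nonneg_le_one ε₁ B).1
  χ_le_one := fun _ B => (B12SmallFieldDomain259.chiFluct_nonneg_le_one ε₁ B).2
  P := Pk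
  Q := Qk

/-- The same with the PRINTED characteristic function (2.9), the product over `b ∉ {b₀(c)}` (`chiFluctPrinted`).
[cite: Balaban1987RG1, (2.9) p.266, (2.12)–(2.13) p.268] -/
def onBondsPrinted (μ : X → Measure (VecField P k 𝔤)) (hμ : ∀ U, IsProbabilityMeasure (μ U)) (ε₁ : ℝ)
    (Pk Qk : ℝ → X → VecField P k 𝔤 → ℝ) : FluctData X where
  𝓑 := VecField P k 𝔤
  m𝓑 := inferInstance
  μ := μ
  prob := hμ
  χ := fun _ B => B12SmallFieldDomain259.chiFluctPrinted ε₁ B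
  χ_nonneg := fun _ B => (B12SmallFieldDomain259.chiFluctPrinted_nonneg_le_one ε₁ B).1
  χ_le_one := fun _ B => (B12SmallFieldDomain259.chiFluctPrinted_nonneg_le_one ε₁ B).2
  P := Pk
  Q := Qk

variable (μ : X → Measure (VecField P k 𝔤)) (hμ : ∀ U, IsProbabilityMeasure (μ U)) (ε₁ : ℝ)
  (Pk Qk : ℝ → X → VecField P k 𝔤 → ℝ)

/-- `χ` of the datum is print's `χ_k` (definitional). [cite: Balaban1987RG1, (2.9) p.266] -/
theorem onBonds_χ (U : X) (B : VecField P k 𝔤) : (onBonds μ hμ ε₁ Pk Qk).χ U B = B12SmallFieldDomain259.chiFluct ε₁ B := rfl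

/-- `χ` of the printed-product datum is `chiFluctPrinted` (definitional). [cite: Balaban1987RG1, (2.9) p.266] -/
theorem onBondsPrinted_χ (U : X) (B : VecField P k 𝔤) : (onBondsPrinted μ hμ ε₁ Pk Qk).χ U B = B12SmallFieldDomain259.chiFluctPrinted ε₁ B := rfl

variable [InnerProductSpace ℝ 𝔤] [BorelSpace 𝔤]

/-- **(2.16) ON PRINT'S CARRIER WITH THE `χ_k` CLAUSE DISCHARGED.**  For a bondwise family of linear isometries `f b : 𝔤 ≃ₗᵢ 𝔤`
(print's `R(u(b₋))`, *«local, orthogonal transformations»*; as a measurable equivalence of the fields: r07's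
`B10Eq26MeasureInv.rot f`, `(rot f B′)(b) = f b (B′(b))`) and a background map `τ`: IF the measures are covariant
(`(dμ_U).map (rot f) = dμ_{τU}`) and `𝐏^{(k)}`, `{…}` are jointly invariant, THEN `𝐄^{(k+1)}(g, τU) = 𝐄^{(k+1)}(g, U)` — the
invariance of `χ_k` is NOT a hypothesis: it is r09's `B12ChiInvariance269.chiFluct_comp_local_isometry` (isometries preserve
`|B′(b)|`). [cite: Balaban1987RG1, (2.16) p.269] -/
theorem newTerm_onBonds_eq_of_covariant (g : ℝ) (τ : X → X) (f : PBond P k → (𝔤 ≃ₗᵢ[ℝ] 𝔤))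
    (hcov : ∀ U, (μ U).map ⇑(B10Eq26MeasureInv.rot f) = μ (τ U))
    (hP : ∀ U B, Pk g (τ U) (B10Eq26MeasureInv.rot f B) = Pk g U B)
    (hQ : ∀ U B, Qk g (τ U) (B10Eq26MeasureInv.rot f B) = Qk g U B) (U : X) :
    (onBonds μ hμ ε₁ Pk Qk).newTerm g (τ U) = (onBonds μ hμ ε₁ Pk Qk).newTerm g U :=
  (onBonds μ hμ ε₁ Pk Qk).newTerm_eq_of_covariant_parts g τ (B10Eq26MeasureInv.rot f) hcov
    (fun _ B => B12ChiInvariance269.chiFluct_comp_local_isometry ε₁ (Equiv.refl _) (fun b => ⇑(f b))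
      (fun b Y => (f b).norm_map Y) B) hP hQ U

/-- The same for the PRINTED `χ_k` (2.9) (product over `b ∉ {b₀(c)}`), by r09's `chiFluctPrinted_comp_local_isometry`.
[cite: Balaban1987RG1, (2.16) p.269, (2.9) p.266] -/
theorem newTerm_onBondsPrinted_eq_of_covariant (g : ℝ) (τ : X → X) (f : PBond P k → (𝔤 ≃ₗᵢ[ℝ] 𝔤))
    (hcov : ∀ U, (μ U).map ⇑(B10Eq26MeasureInv.rot f) = μ (τ U))
    (hP : ∀ U B, Pk g (τ U) (B10Eq26MeasureInv.rot f B) = Pk g U B)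
    (hQ : ∀ U B, Qk g (τ U) (B10Eq26MeasureInv.rot f B) = Qk g U B) (U : X) :
    (onBondsPrinted μ hμ ε₁ Pk Qk).newTerm g (τ U) = (onBondsPrinted μ hμ ε₁ Pk Qk).newTerm g U :=
  (onBondsPrinted μ hμ ε₁ Pk Qk).newTerm_eq_of_covariant_parts g τ (B10Eq26MeasureInv.rot f) hcov
    (fun _ B => B12ChiInvariance269.chiFluctPrinted_comp_local_isometry ε₁ (Equiv.refl _) (fun _ => Iff.rfl)
      (fun b => ⇑(f b)) (fun b Y => (f b).norm_map Y) B) hP hQ U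

/-- PRINT'S `R(u)`: with `f b := R(u(b₋))` for a representation `R : G → (𝔤 ≃ₗᵢ 𝔤)` by isometries and a gauge transformation
`u`, the field map IS r09's `B12ChiInvariance269.rotFluct (fun g => ⇑(R g)) u` — `(R(u)B′)(b) = R(u(b₋))B′(b)` (2.16) — pointwise.
[cite: Balaban1987RG1, (2.16) p.269] -/
theorem rot_gauge_apply {G : Type*} (R : G → (𝔤 ≃ₗᵢ[ℝ] 𝔤)) (u : GaugeTransf P k G) (B : VecField P k 𝔤) :
    B10Eq26MeasureInv.rot (fun b : PBond P k => R (u b.src)) B = B12ChiInvariance269.rotFluct (fun g => ⇑(R g)) u B := rfl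

/-- **(2.16) verbatim on print's carrier**: for `U_{k+1} ↦ U^u_{k+1}` (`τ`) and `B′ ↦ R(u)B′` with `R` a representation of `G` on `𝔤`
by isometries (the adjoint action for the Killing ∕ trace form), covariant measures and invariant `𝐏^{(k)}`, `{…}` give the gauge
invariance of (2.13) for print's `χ_k` — no `χ_k` hypothesis. [cite: Balaban1987RG1, (2.16) p.269] -/
theorem newTerm_onBonds_gauge_invariant {G : Type*} (g : ℝ) (τ : X → X) (R : G → (𝔤 ≃ₗᵢ[ℝ] 𝔤)) (u : GaugeTransf P k G)
    (hcov : ∀ U, (μ U).map ⇑(B10Eq26MeasureInv.rot fun b : PBond P k => R (u b.src)) = μ (τ U))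
    (hP : ∀ U B, Pk g (τ U) (B12ChiInvariance269.rotFluct (fun g => ⇑(R g)) u B) = Pk g U B)
    (hQ : ∀ U B, Qk g (τ U) (B12ChiInvariance269.rotFluct (fun g => ⇑(R g)) u B) = Qk g U B) (U : X) :
    (onBonds μ hμ ε₁ Pk Qk).newTerm g (τ U) = (onBonds μ hμ ε₁ Pk Qk).newTerm g U :=
  newTerm_onBonds_eq_of_covariant μ hμ ε₁ Pk Qk g τ (fun b => R (u b.src)) hcov hP hQ U

end FluctData

end OnBonds

end

end Literature.MathematicalPhysics.QuantumFieldTheory.Balaban1983to89.B12Eq213Body268
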